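import Literature.NumberTheory.LFunctions.DirichletThetaTransformation
import Literature.NumberTheory.LFunctions.SelbergClassDirichletProofs
import Literature.Analysis.SpecialFunctions.LogPiBounds
import Literature.Analysis.SpecialFunctions.EulerMascheroniBounds
import Mathlib.MeasureTheory.Integral.ExpDecay
import Mathlib.NumberTheory.Harmonic.GammaDeriv
import Mathlib.NumberTheory.Harmonic.ZetaAsymp
import HarnessLib

/-!
# Louboutin's explicit upper bound `|L(1, χ)| ≤ ½ log f + (2 + γ − log 4π)/2` for even primitive characters (proved)

Topic `Literature/NumberTheory/LFunctions`, namespace `Literature.NumberTheory.LFunctions.Louboutin2001`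
(grouping sub-namespace naming the paper). Everything in this file is PROVED from Mathlib and the tree
(no named facts, no new notions beyond the private majorant `T` and the constant `µ_ℚ` of the source).
Typed by the cross-ladder literature-typing seat `littype-FP2-1` (cell `parity-realchar`, D-0088 (4) row (7),
«conditionals column + instrument provenance»): it supplies, as a KERNEL theorem, the
`|L(1, χ)| ≤ ½ log q + O(1)` input that the explicit Siegel–Tatuzawa line consumes (Hoffstein 1980 (14),
Ji–Lu 2004 Lemma 4 = Louboutin, Chen 2007 Lemma 3 = Ramaré; see `SiegelTatuzawaExplicit.lean`) and that
the tree so far held only as NAMED FACTS (`ExplicitLOneUpperBounds.lean`: `ramare2001_corollary1`,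
`½ log q + 0` / `+ 0.7082`) or in Pólya–Vinogradov quality
(`DirichletLOnePolyaVinogradovBound.lean`: `½ log q + log log q + 2`, proved).

Appended (section `EvenConductor`): **the even-conductor refinement** `|L(1, χ)| ≤ ¼ log f + (2 + γ − log π)/4`
(`= ¼ log f + 0.3581…`) for even primitive `χ` with `2 ∣ f`, `f ≥ 8` — Louboutin, C. R. Acad. Sci. Paris 316 (1993),
second inequality [Louboutin1993CRAS] (text not held: acq-14240; statement quoted verbatim by Zbl 0774.11051, read):
`χ(n) = 0` for even `n` halves the Gaussian majorant to `2(T(y/f) − T(4y/f))` (`norm_dirichletTheta_zero_le_sub`),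
the split-and-fold bound for a general majorant (`norm_integral_le_of_majorant`) gives `√f|L(1,χ)| ≤ fold(f) − fold(f/4)`,
and the fold from BELOW with its exponentially small tail (`fold_ge`) evaluates the difference
(`norm_LFunction_one_le_quarter_log`, `_add`). Compare the NAMED `ramare2001_corollary3` (`¼ log q + ½ log 2 = 0.3466`).

## Source, as printed (read first-hand: text PDF `paper:doi-10-4153-cjm-2001-045-5`)

S. Louboutin, *Explicit upper bounds for residues of Dedekind zeta functions and values of `L`-functions
at `s = 1`, and explicit lower bounds for relative class numbers of CM-fields*, Canad. J. Math. 53 (2001)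
1194–1222 [Louboutin2001CJM].

* §2.1 p. 1195: «`A_L = √(d_L/4^{r₂}π^m)`, `Γ_L(s) = Γ^{r₁}(s/2)Γ^{r₂}(s)`, `F_L(s) = A_L^s Γ_L(s) ζ_L(s)`,
  `λ_L = Res_{s=1}(F_L)`, `µ_L = lim_{s↓1} {λ_L^{−1} F_L(s) − 1/(s(s−1))}` … Notice that
  `µ_ℚ = (2 + γ − log(4π))/2 = 0.023095…` where `γ = 0.577215…` denotes Euler's constant.»
  (For `L = ℚ`: `F_ℚ(s) = π^{−s/2}Γ(s/2)ζ(s)` = Mathlib's `completedRiemannZeta`, `λ_ℚ = 1`, and since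
  `1/(s(s−1)) = 1/(s−1) − 1/s`, `µ_ℚ = Λ₀(1)` with Mathlib's entire `completedRiemannZeta₀ = Λ + 1/s + 1/(1−s)`.)
* **Theorem 7** (p. 1197): «Let `χ` be an even primitive Dirichlet character modulo `f_χ > 1`.
  1. (See also [Lou1], [Lou12] and [Ram]). Then
  **(15)** `|L(1, χ)| ≤ ½ (log f_χ + 2µ_ℚ) ≤ ½ (log f_χ + 0.05)`.
  2. Moreover, `½ ≤ β < 1` and `L(β, χ) = 0` imply **(16)** `|L(1, χ)| ≤ (1−β)/8 · log² f_χ`.»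
  (Only (15) is proved here; (16) needs the second assertion of Prop. 28, i.e. (50) — NOT in this file.)
* §4 pp. 1206–1210 (the integral representation): for `f(s) = Σ a_n n^{−s}`, `F_f(s) = A_f^s Γ_f(s) f(s)`,
  `S_f = M^{−1}F_f = Σ_n a_n(f) H_f(nx/A_f)` (35), `H_f = M^{−1}Γ_f > 0`; functional equation
  **(39)** `(1/x) S_f(1/x) = W_f S_f(x) + h_f(x)`; **Theorem 21** (42)–(43):
  `F_f(s) = R_f(s) + I_f(s)`, `I_f(s) = ∫₁^∞ S_f(x) x^{s−1} dx + W_f ∫₁^∞ S_f(x) x^{−s} dx`, and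
  **(44)** `I_f(1) = p₀ − W_f Σ_{k≥1} (−1)^k p̄_k`; **Theorem 23** (p. 1210): «Let `f₁` and `f₂` be two
  Dirichlet series for which `Γ_{f₁} = Γ_{f₂}`, `|a_n(f₁)| ≤ a_n(f₂)` (for all `n ≥ 1`) and `W_{f₂} = 1`.
  Set `d = A_{f₁}/A_{f₂}` … Assume `½ ≤ β ≤ 1`. It holds
  **(45)** `|I_{f₁}(β)| ≤ J_{f₂}(d) := (d + 1) I_{f₂}(1) + d ∫₁^d h_{f₂}(x) dx/x + ∫₁^d h_{f₂}(x) dx`»,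
  proof p. 1211 (51)–(52): «`|S_{f₁}(x)| ≤ S_{f₂}(x/d)` … `|I_{f₁}(β)| ≤ ∫₁^∞ S_{f₂}(x/d)(x^{β−1} + x^{−β}) dx
  ≤ ∫₁^∞ S_{f₂}(x/d) dx + ∫₁^∞ S_{f₂}(x/d) dx/x = …`» (fold of `(1/d, 1)` onto `(1, d)` by (39)).
* **Proposition 28** (p. 1219, `f₁ = L(s, χ)`, `f₂ = ζ`, `R_{f₁} = 0`, `I_{f₁} = F_{f₁} = F_χ`, `d = √f_χ`,
  `F_{f₂}(s) = π^{−s/2}Γ(s/2)ζ(s) = p₁/(s−1) + p₀ + …`, `p₁ = 1`, `µ_ℚ = p₀ + p₁`): «(47) in Theorem 23 gives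
  `|I_{f₁}(β)| ≤ (p₀ + p₁)(d + 1) + p₁(d − 1) log d = d(log d + µ_ℚ) + (µ_ℚ − log d)`, which yields the
  first assertion» `|F_χ(β)|/√f_χ ≤ ½ log f_χ + µ_ℚ`; §6.6.2 p. 1220: «We have `F_χ(1) = √f_χ L(1, χ)` so
  that the first point of Proposition 28 yields (15).»
[cite: Louboutin2001CJM, Thm 7 (15) p. 1197 / Thm 23 (45) p. 1210 / Prop 28 p. 1219]

## What is proved (and how it maps onto the printed proof)

We follow the printed proof with `f₂ = ζ` throughout, in the variable `y = x²` of the tree's theta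
representation (`S_ζ(x) = 2T(x²)`, `S_χ(x) = ϑ₀(x², χ)`):
* `thetaMajor` — `T(t) = Σ_{n≥1} e^{−πn²t} = (θ(t) − 1)/2` (`θ = ` Mathlib's `evenKernel 0`; the tree's
  `LagariasRains2003.theta` is the full `θ`), with Jacobi's (39): `T(1/t) = √t T(t) + (√t − 1)/2`
  (`thetaMajor_inv`, from Mathlib's `evenKernel_functional_equation`), the geometric majorant
  `T(t) ≤ e^{−πt}/(1 − e^{−3πt})`, and `µ_ℚ := ∫₁^∞ T(v)(v^{−1/2} + v^{−1}) dv` (`mu`) — this is `I_ζ(1)`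
  of (43)–(44) after `v = x²`;
* `fold` — Theorem 23 (45) for `f₂ = ζ` at `β = 1`: `∫₁^∞ T(y/Q)(y^{−1/2} + y^{−1}) dy ≤ (√Q + 1)µ_ℚ +
  ½(√Q − 1) log Q` (the `h_ζ`-terms `d∫₁^d h dx/x + ∫₁^d h dx` with `h_ζ(x) = 1 − 1/x` give `(d − 1) log d`,
  `integral_hTerms`);
* `norm_integral_le_majorant` — (43) + (51): the split of `ξ(1, χ) = ½∫₀^∞ ϑ₀(y, χ) y^{−1/2} dy` at
  `y = 1`, the fold of `(0, 1)` by the transformation formula `ϑ₀(y, χ) = ε(χ) y^{−1/2} ϑ₀(1/y, χ̄)`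
  (tree: `DirichletTheta.dirichletTheta_transformation`, `|ε(χ)| = 1`: `SelbergDirichlet.norm_rootNumber`)
  and the majorant `|ϑ₀(y, χ)| ≤ 2T(y/q)` (`norm_dirichletTheta_zero_le` = «`|S_{f₁}(x)| ≤ S_{f₂}(x/d)`»);
* `sqrt_mul_norm_LFunction_one_le` — Prop. 28 first assertion at `β = 1` with §6.6.2:
  **`√q · |L(1, χ)| ≤ (√q + 1) µ_ℚ + ½ (√q − 1) log q`** for every even primitive `χ ≠ 1` mod `q`
  (`ξ(1, χ) = √q L(1, χ)`: tree `dirichletXi_eq_LFunction_mul`, `dirichletXi_eq_mellin`);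
* `completedRiemannZeta₀_one_eq_mu` — **`µ_ℚ = Λ₀(1)`** (`completedRiemannZeta₀ 1 = µ`): Louboutin's
  definition of `µ_ℚ` (p. 1195) agrees with `I_ζ(1)` ((44)), by Riemann's split of
  `∫₀^∞ (θ − 1) t^{s/2} dt/t` inside Mathlib's `WeakFEPair.f_modif`;
* `completedRiemannZeta₀_one`, `mu_eq` — **`µ_ℚ = (2 + γ − log 4π)/2`** (p. 1195), from Mathlib's
  `tendsto_riemannZeta_sub_one_div` (`ζ(s) − 1/(s−1) → γ`) and `hasDerivAt_Gammaℝ_one`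
  (`Γ_ℝ'(1) = −(γ + log 4π)/2`); `lt_mu`/`mu_lt`: `0.023 < µ_ℚ < 0.0231` (tree: `Real.log_pi_gt_d20`,
  `eulerMascheroniConstant_lt_d8`; Mathlib: `Real.log_two_gt_d9`);
* **`norm_LFunction_one_le`** — THEOREM 7 (15): for `χ` primitive mod `q`, `χ ≠ 1`, `χ(−1) = 1`:
  **`|L(1, χ)| ≤ ½ log q + (2 + γ − log 4π)/2`**; `norm_LFunction_one_le_half_log_add` — the printed
  second form **`|L(1, χ)| ≤ ½ (log q + 0.05)`**; `norm_LFunction_one_le_half_log_add_d4` —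
  `|L(1, χ)| ≤ ½ log q + 0.0231` (decimal for consumers); `norm_LFunction_one_le_sub` keeps the
  `−(½ log q − µ_ℚ)/√q` saving of Prop. 28.

NOT here: odd characters (Louboutin's `½(log f + 2 + γ − log π)`, C. R. Acad. Sci. 316 (1993) — a
different comparison), (16) and Theorem 5/(13) for general number fields, Ramaré's sharper constants
(`ramare2001_corollary1`, named). TODO(general form): Theorem 23 for a general pair `(f₁, f₂)`.

LABEL (cell rule): statement layer → kernel theorem; unconditional; no compute; no Parity credit (H5).

## References

* [Louboutin2001CJM] S. Louboutin, Canad. J. Math. 53 (2001) 1194–1222, §2.1 p. 1195, Thm 7 (15) p. 1197,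
  §4 Thms 20–23 pp. 1207–1212, Prop 28 / §6.6.2 pp. 1219–1220 (doi:10.4153/cjm-2001-045-5, MR1863848).
* [MontgomeryVaughan2007] §10.1 Thm 10.6 / (10.16)–(10.19) (theta series and transformation formula —
  tree files `DirichletLThetaRepresentation.lean`, `DirichletThetaTransformation.lean`).
* [Ramare2001LOneApproximateFormulae] Cor 1 p. 248 (the named sharper bound, `ExplicitLOneUpperBounds.lean`).
-/

noncomputable section

open Complex Real MeasureTheory Filter Topology Set HurwitzZeta

namespace Literature.NumberTheory.LFunctions

namespace Louboutin2001

/-- The theta majorant `T(t) = Σ_{n ≥ 1} e^{−π n² t}` (`= ω(t) = (θ(t) − 1)/2` with Jacobi's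
`θ(t) = Σ_{n ∈ ℤ} e^{−πn²t}`); Louboutin's `S_ζ(x) = 2T(x²)`. [cite: Louboutin2001CJM, §6.6.1 p. 1219] -/
def thetaMajor (t : ℝ) : ℝ := ∑' n : ℕ, rexp (-(π * ((n : ℝ) + 1) ^ 2 * t))

/-- The terms `e^{−π(n+1)²t}`, `n ∈ ℕ`, are summable for `t > 0`. [folklore] -/
private theorem summable_thetaMajor_term {t : ℝ} (ht : 0 < t) :
    Summable (fun n : ℕ ↦ rexp (-(π * ((n : ℝ) + 1) ^ 2 * t))) := by
  have h := (hasSum_int_evenKernel 0 ht).summable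
  have hinj : Function.Injective (fun n : ℕ ↦ ((n : ℤ) + 1)) := fun a b hab ↦ by simpa using hab
  have h2 := h.comp_injective hinj
  refine h2.congr fun n ↦ ?_
  simp only [Function.comp_apply]
  push_cast
  ring_nf

/-- `T(t)` is the sum of its series for `t > 0` — Louboutin's «`S_{f₂}(x) = 2Σ_{n≥1} e^{−πn²x²}`» (`f₂ = ζ`) at
`t = x²`. [cite: Louboutin2001CJM, Prop 28 (proof) p. 1219] -/
theorem hasSum_thetaMajor {t : ℝ} (ht : 0 < t) :
    HasSum (fun n : ℕ ↦ rexp (-(π * ((n : ℝ) + 1) ^ 2 * t))) (thetaMajor t) :=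
  (summable_thetaMajor_term ht).hasSum

/-- `T ≥ 0` — «the most important observation is that we have `H_f(x) > 0` for `x > 0`», whence
`S_{f₂} ≥ 0` (§4.3). [cite: Louboutin2001CJM, §4.3 p. 1208] -/
theorem thetaMajor_nonneg (t : ℝ) : 0 ≤ thetaMajor t :=
  tsum_nonneg fun _ ↦ (Real.exp_pos _).le

/-- **Jacobi's `θ = 1 + 2ω`**: `evenKernel 0 t = Σ_{n∈ℤ} e^{−πn²t} = 1 + 2T(t)` for `t > 0`. [folklore] -/
private theorem evenKernel_zero_eq {t : ℝ} (ht : 0 < t) :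
    evenKernel 0 t = 1 + 2 * thetaMajor t := by
  -- the `ℤ`-indexed series
  have hZ : HasSum (fun n : ℤ ↦ rexp (-(π * (n : ℝ) ^ 2 * t))) (evenKernel 0 t) := by
    have h := hasSum_int_evenKernel 0 ht
    simp only [add_zero, QuotientAddGroup.mk_zero] at h
    refine h.congr_fun fun n ↦ ?_
    ring_nf
  -- fold `n ↦ (n, -(n+1))`
  have hN := hZ.nat_add_neg_add_one
  -- the shifted ℕ-series
  have hT := hasSum_thetaMajor ht
  have hT0 : HasSum (fun n : ℕ ↦ rexp (-(π * (n : ℝ) ^ 2 * t))) (thetaMajor t + 1) := by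
    set F : ℕ → ℝ := fun n ↦ rexp (-(π * (n : ℝ) ^ 2 * t)) with hF
    have h1 : HasSum (fun n : ℕ ↦ F (n + 1)) (thetaMajor t) := by
      refine hT.congr_fun fun n ↦ ?_
      simp only [hF]; push_cast; ring_nf
    have h2 : HasSum F (thetaMajor t + ∑ i ∈ Finset.range 1, F i) := (hasSum_nat_add_iff 1).mp h1
    simpa [hF] using h2
  have hsum : HasSum (fun n : ℕ ↦ rexp (-(π * (n : ℝ) ^ 2 * t)) + rexp (-(π * ((n : ℝ) + 1) ^ 2 * t)))
      (thetaMajor t + 1 + thetaMajor t) := hT0.add hT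
  have hN' : HasSum (fun n : ℕ ↦ rexp (-(π * (n : ℝ) ^ 2 * t)) + rexp (-(π * ((n : ℝ) + 1) ^ 2 * t)))
      (evenKernel 0 t) := by
    refine hN.congr_fun fun n ↦ ?_
    push_cast
    ring_nf
  have := hN'.unique hsum
  rw [this]; ring

/-- `T(t) = (evenKernel 0 t − 1)/2` for `t > 0`. [folklore] -/
private theorem thetaMajor_eq_evenKernel {t : ℝ} (ht : 0 < t) :
    thetaMajor t = (evenKernel 0 t - 1) / 2 := by
  rw [evenKernel_zero_eq ht]; ring

/-- `T` is continuous on `(0, ∞)`. [folklore] -/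
private theorem continuousOn_thetaMajor : ContinuousOn thetaMajor (Ioi 0) := by
  have h : ContinuousOn (fun t ↦ (evenKernel 0 t - 1) / 2) (Ioi 0) :=
    ((continuousOn_evenKernel 0).sub continuousOn_const).div_const _
  exact h.congr fun t ht ↦ thetaMajor_eq_evenKernel ht

/-- **Jacobi's transformation for the majorant**: `T(1/t) = √t · T(t) + (√t − 1)/2` for `t > 0` — the
functional equation (39) `(1/x) S_f(1/x) = W_f S_f(x) + h_f(x)` for `f = ζ` (`W = 1`, `h_ζ(x) = 1 − 1/x`,
`S_ζ(x) = 2T(x²)`), i.e. `θ(1/t) = √t θ(t)` (Mathlib `evenKernel_functional_equation`). [cite: Louboutin2001CJM, (39) p. 1209] -/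
theorem thetaMajor_inv {t : ℝ} (ht : 0 < t) :
    thetaMajor (1 / t) = t ^ (1 / 2 : ℝ) * thetaMajor t + (t ^ (1 / 2 : ℝ) - 1) / 2 := by
  have ht' : 0 < 1 / t := by positivity
  have hfe := evenKernel_functional_equation 0 (1 / t)
  rw [evenKernel_eq_cosKernel_of_zero.symm, one_div_one_div] at hfe
  -- hfe : evenKernel 0 (1/t) = 1 / (1/t)^(1/2) * evenKernel 0 t
  rw [evenKernel_zero_eq ht, evenKernel_zero_eq ht'] at hfe
  have hpow : 1 / (1 / t) ^ (1 / 2 : ℝ) = t ^ (1 / 2 : ℝ) := by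
    rw [one_div (t : ℝ), Real.inv_rpow ht.le, one_div, inv_inv]
  rw [hpow] at hfe
  linarith

/-- Geometric majorant: `T(t) ≤ e^{−πt}/(1 − e^{−3πt})` for `t > 0`
(`(n+1)² ≥ 1 + 3n`). [folklore] -/
private theorem thetaMajor_le_geom {t : ℝ} (ht : 0 < t) :
    thetaMajor t ≤ rexp (-(π * t)) / (1 - rexp (-(3 * π * t))) := by
  have hr0 : 0 ≤ rexp (-(3 * π * t)) := (Real.exp_pos _).le
  have hr1 : rexp (-(3 * π * t)) < 1 := by
    rw [Real.exp_lt_one_iff]; have := Real.pi_pos; nlinarith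
  have hgeom : HasSum (fun n : ℕ ↦ rexp (-(π * t)) * rexp (-(3 * π * t)) ^ n)
      (rexp (-(π * t)) * (1 - rexp (-(3 * π * t)))⁻¹) :=
    (hasSum_geometric_of_lt_one hr0 hr1).mul_left _
  rw [div_eq_mul_inv]
  refine hasSum_le (fun n ↦ ?_) (hasSum_thetaMajor ht) hgeom
  rw [← Real.exp_nat_mul, ← Real.exp_add, Real.exp_le_exp]
  have hn : (n : ℝ) ≤ (n : ℝ) ^ 2 := by exact_mod_cast Nat.le_self_pow two_ne_zero n
  have := mul_pos Real.pi_pos ht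
  nlinarith [mul_le_mul_of_nonneg_left hn this.le]

/-- The weight `w(v) = v^{−1/2} + v^{−1}` of Louboutin's `I_ζ(1) = ∫₁^∞ S_ζ(x)(1 + 1/x)dx` in the
variable `v = x²`. [cite: Louboutin2001CJM, (43)–(44) p. 1209] -/
def weight (v : ℝ) : ℝ := v ^ (-(1 / 2 : ℝ)) + v⁻¹

/-- `w(v) ≥ 0` for `v > 0`. [folklore] -/
private theorem weight_nonneg {v : ℝ} (hv : 0 < v) : 0 ≤ weight v := by
  unfold weight; positivity

/-- `w(v) ≤ 2` for `v ≥ 1`. [folklore] -/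
private theorem weight_le_two {v : ℝ} (hv : 1 ≤ v) : weight v ≤ 2 := by
  unfold weight
  have h1 : v ^ (-(1 / 2 : ℝ)) ≤ 1 := by
    apply Real.rpow_le_one_of_one_le_of_nonpos hv; norm_num
  have h2 : v⁻¹ ≤ 1 := inv_le_one_of_one_le₀ hv
  linarith

/-- `w` is continuous on `(0, ∞)`. [folklore] -/
private theorem continuousOn_weight : ContinuousOn weight (Ioi 0) := by
  unfold weight
  refine ContinuousOn.add ?_ (continuousOn_inv₀.mono fun x (hx : 0 < x) ↦ hx.ne')
  exact continuousOn_id.rpow_const fun x hx ↦ Or.inl (ne_of_gt hx)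

/-- **Louboutin's constant** `µ_ℚ = I_ζ(1) = ∫₁^∞ S_ζ(x)(1 + 1/x) dx = ∫₁^∞ T(v)(v^{−1/2} + v^{−1}) dv`
(`S_ζ(x) = 2T(x²)`; `= (2 + γ − log 4π)/2 = 0.023095…`, p. 1195). [cite: Louboutin2001CJM, §2.1 p. 1195 / (44) p. 1209] -/
def mu : ℝ := ∫ v in Ioi 1, thetaMajor v * weight v

/-- `µ_ℚ ≥ 0`. [cite: Louboutin2001CJM, §2.1 p. 1195] -/
theorem mu_nonneg : 0 ≤ mu :=
  setIntegral_nonneg measurableSet_Ioi fun v (hv : 1 < v) ↦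
    mul_nonneg (thetaMajor_nonneg v) (weight_nonneg (by linarith))


/-! ### Integrability of `T · g` on half-lines -/

/-- For `a > 0` and `g` continuous on `(0, ∞)` with `|g| ≤ B` on `(a, ∞)`, `v ↦ T(v) g(v)` is
integrable on `(a, ∞)` (domination by `B e^{−πv}/(1 − e^{−3πa})`). [folklore] -/
private theorem integrableOn_thetaMajor_mul {a B : ℝ} (ha : 0 < a) {g : ℝ → ℝ} (hg : ContinuousOn g (Ioi 0))
    (hB : ∀ v, a < v → |g v| ≤ B) :
    IntegrableOn (fun v ↦ thetaMajor v * g v) (Ioi a) := by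
  have hmeas : AEStronglyMeasurable (fun v ↦ thetaMajor v * g v) (volume.restrict (Ioi a)) := by
    refine ContinuousOn.aestronglyMeasurable ?_ measurableSet_Ioi
    exact (continuousOn_thetaMajor.mono (Ioi_subset_Ioi ha.le)).mul (hg.mono (Ioi_subset_Ioi ha.le))
  have hq0 : rexp (-(3 * π * a)) < 1 := by
    rw [Real.exp_lt_one_iff]; have := Real.pi_pos; nlinarith
  set C : ℝ := (1 - rexp (-(3 * π * a)))⁻¹ with hC
  have hCpos : 0 < C := inv_pos.mpr (by linarith)
  have hdom : IntegrableOn (fun v : ℝ ↦ B * C * rexp (-π * v)) (Ioi a) :=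
    ((exp_neg_integrableOn_Ioi a Real.pi_pos).const_mul _)
  refine Integrable.mono' hdom hmeas ?_
  refine (ae_restrict_iff' measurableSet_Ioi).mpr (ae_of_all _ fun v (hv : a < v) ↦ ?_)
  have hv0 : 0 < v := ha.trans hv
  have hB0 : 0 ≤ B := (abs_nonneg _).trans (hB v hv)
  rw [norm_mul, Real.norm_eq_abs, Real.norm_eq_abs, abs_of_nonneg (thetaMajor_nonneg v)]
  have h1 := thetaMajor_le_geom hv0
  have hA : rexp (-(3 * π * v)) ≤ rexp (-(3 * π * a)) := by
    rw [Real.exp_le_exp]; nlinarith [Real.pi_pos]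
  have h2 : thetaMajor v ≤ C * rexp (-π * v) := by
    calc thetaMajor v ≤ rexp (-(π * v)) / (1 - rexp (-(3 * π * v))) := h1
      _ ≤ rexp (-(π * v)) / (1 - rexp (-(3 * π * a))) :=
          div_le_div_of_nonneg_left (Real.exp_pos _).le (by linarith) (by linarith)
      _ = C * rexp (-π * v) := by rw [hC, div_eq_inv_mul, neg_mul]
  calc thetaMajor v * |g v| ≤ (C * rexp (-π * v)) * B :=
        mul_le_mul h2 (hB v hv) (abs_nonneg _) (by positivity)
    _ = B * C * rexp (-π * v) := by ring

/-- `A = ∫₁^∞ T(v) v^{−1/2} dv` and `B = ∫₁^∞ T(v) v^{−1} dv` exist. [folklore] -/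
private theorem integrableOn_thetaMajor_mul_rpow (r : ℝ) (hr : r ≤ 0) :
    IntegrableOn (fun v ↦ thetaMajor v * v ^ r) (Ioi 1) := by
  refine integrableOn_thetaMajor_mul (B := 1) one_pos
    (continuousOn_id.rpow_const fun x hx ↦ Or.inl (ne_of_gt hx)) fun v hv ↦ ?_
  rw [abs_of_nonneg (Real.rpow_nonneg (by linarith) _)]
  exact Real.rpow_le_one_of_one_le_of_nonpos hv.le hr

/-- `µ_ℚ = A + B` with `A = ∫₁^∞ T v^{−1/2}`, `B = ∫₁^∞ T v^{−1}` (the two integrals of `I_f(1)`, (43)). [cite: Louboutin2001CJM, (43) p. 1209] -/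
theorem mu_eq_add : mu = (∫ v in Ioi 1, thetaMajor v * v ^ (-(1 / 2 : ℝ))) +
    ∫ v in Ioi 1, thetaMajor v * v⁻¹ := by
  rw [mu, ← integral_add (integrableOn_thetaMajor_mul_rpow _ (by norm_num))]
  · refine setIntegral_congr_fun measurableSet_Ioi fun v _ ↦ ?_
    simp only [weight]; ring
  · have := integrableOn_thetaMajor_mul_rpow (-1) (by norm_num)
    refine this.congr_fun (fun v (hv : 1 < v) ↦ ?_) measurableSet_Ioi
    simp only [Real.rpow_neg_one]

/-! ### Louboutin's fold (Theorem 23 (45) p. 1210 with `f₂ = ζ`, in the variable `v = x²`) -/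

/-- Elementary integral: `∫₁^Q (Q^{1/2} w^{−1} + w^{−1/2} − Q^{1/2} w^{−3/2} − w^{−1}) dw = (Q^{1/2} − 1) log Q`
(the `h_{f₂}`-terms of (45): `d∫₁^d h(x)dx/x + ∫₁^d h(x)dx = (d − 1) log d`, `h_ζ(x) = 1 − 1/x`,
`d = Q^{1/2}`). [cite: Louboutin2001CJM, Thm 23 (45) p. 1210] -/
theorem integral_hTerms {Q : ℝ} (hQ : 1 ≤ Q) :
    ∫ w in (1 : ℝ)..Q, (Q ^ (1 / 2 : ℝ) * w⁻¹ + w ^ (-(1 / 2 : ℝ)) - Q ^ (1 / 2 : ℝ) * w ^ (-(3 / 2 : ℝ)) - w⁻¹)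
      = (Q ^ (1 / 2 : ℝ) - 1) * Real.log Q := by
  have hQ0 : 0 < Q := by linarith
  have h0 : (0 : ℝ) ∉ Set.uIcc (1 : ℝ) Q := by
    rw [Set.uIcc_of_le hQ]; intro h; exact absurd h.1 (by norm_num)
  have i1 : ∫ w in (1 : ℝ)..Q, w⁻¹ = Real.log Q := by
    rw [integral_inv_of_pos one_pos hQ0, div_one]
  have i2 : ∫ w in (1 : ℝ)..Q, w ^ (-(1 / 2 : ℝ)) = 2 * Q ^ (1 / 2 : ℝ) - 2 := by
    rw [integral_rpow (Or.inr ⟨by norm_num, h0⟩)]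
    rw [Real.one_rpow]; norm_num; ring
  have i3 : ∫ w in (1 : ℝ)..Q, w ^ (-(3 / 2 : ℝ)) = 2 - 2 * Q ^ (-(1 / 2 : ℝ)) := by
    rw [integral_rpow (Or.inr ⟨by norm_num, h0⟩)]
    rw [Real.one_rpow]; norm_num; ring
  have hc1 : IntervalIntegrable (fun w : ℝ ↦ w⁻¹) volume 1 Q :=
    intervalIntegral.intervalIntegrable_inv (fun x hx ↦ by
      rw [Set.uIcc_of_le hQ] at hx; exact (show (0 : ℝ) < x by linarith [hx.1]).ne') continuousOn_id
  have hc2 : IntervalIntegrable (fun w : ℝ ↦ w ^ (-(1 / 2 : ℝ))) volume 1 Q :=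
    intervalIntegral.intervalIntegrable_rpow (Or.inr h0)
  have hc3 : IntervalIntegrable (fun w : ℝ ↦ w ^ (-(3 / 2 : ℝ))) volume 1 Q :=
    intervalIntegral.intervalIntegrable_rpow (Or.inr h0)
  have hsq : Q ^ (1 / 2 : ℝ) * Q ^ (-(1 / 2 : ℝ)) = 1 := by
    rw [← Real.rpow_add hQ0]; norm_num
  rw [intervalIntegral.integral_sub ((hc1.const_mul _).add hc2 |>.sub (hc3.const_mul _)) hc1,
    intervalIntegral.integral_sub ((hc1.const_mul _).add hc2) (hc3.const_mul _),
    intervalIntegral.integral_add (hc1.const_mul _) hc2,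
    intervalIntegral.integral_const_mul, intervalIntegral.integral_const_mul, i1, i2, i3]
  linear_combination (2 : ℝ) * hsq

/-- The weight after scaling: `Q · w(Qv) = Q^{1/2} v^{−1/2} + v^{−1}`. [folklore] -/
private theorem mul_weight_mul {Q v : ℝ} (hQ : 0 < Q) (hv : 0 < v) :
    Q * weight (Q * v) = Q ^ (1 / 2 : ℝ) * v ^ (-(1 / 2 : ℝ)) + v⁻¹ := by
  unfold weight
  rw [Real.mul_rpow hQ.le hv.le, mul_inv]
  have h1 : Q * Q ^ (-(1 / 2 : ℝ)) = Q ^ (1 / 2 : ℝ) := by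
    conv_lhs => rw [show Q * Q ^ (-(1 / 2 : ℝ)) = Q ^ (1 : ℝ) * Q ^ (-(1 / 2 : ℝ)) by rw [Real.rpow_one]]
    rw [← Real.rpow_add hQ]; norm_num
  have h2 : Q * Q⁻¹ = 1 := mul_inv_cancel₀ hQ.ne'
  linear_combination v ^ (-(1 / 2 : ℝ)) * h1 + v⁻¹ * h2

/-- Jacobi-folded integrand on `(1, Q)`: for `w > 0`,
`T(1/w) (Q^{1/2} (1/w)^{−1/2} + (1/w)^{−1}) w^{−2} = T(w)(Q^{1/2} w^{−1} + w^{−1/2})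
  + ½ (Q^{1/2} w^{−1} + w^{−1/2} − Q^{1/2} w^{−3/2} − w^{−1})` — (39) with `h_ζ(x) = 1 − 1/x`
inserted in (51)–(52). [cite: Louboutin2001CJM, (39) p. 1209 / (52) p. 1211] -/
theorem folded_integrand {Q w : ℝ} (hw : 0 < w) :
    thetaMajor (1 / w) * (Q ^ (1 / 2 : ℝ) * (1 / w) ^ (-(1 / 2 : ℝ)) + (1 / w)⁻¹) * (w ^ 2)⁻¹ =
      thetaMajor w * (Q ^ (1 / 2 : ℝ) * w⁻¹ + w ^ (-(1 / 2 : ℝ))) +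
      (1 / 2 : ℝ) * (Q ^ (1 / 2 : ℝ) * w⁻¹ + w ^ (-(1 / 2 : ℝ)) - Q ^ (1 / 2 : ℝ) * w ^ (-(3 / 2 : ℝ)) - w⁻¹) := by
  rw [thetaMajor_inv hw]
  have e1 : (1 / w) ^ (-(1 / 2 : ℝ)) = w ^ (1 / 2 : ℝ) := by
    rw [one_div, Real.inv_rpow hw.le, ← Real.rpow_neg hw.le, neg_neg]
  have e2 : (1 / w)⁻¹ = w := by rw [one_div, inv_inv]
  rw [e1, e2]
  -- express everything via s = w^{1/2}, with s^2 = w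
  set s := w ^ (1 / 2 : ℝ) with hs
  have hs0 : 0 < s := Real.rpow_pos_of_pos hw _
  have hs2 : s ^ 2 = w := by
    rw [hs, ← Real.rpow_natCast, ← Real.rpow_mul hw.le]; norm_num
  have e3 : w ^ (-(1 / 2 : ℝ)) = s⁻¹ := by
    rw [hs, Real.rpow_neg hw.le]
  have e4 : w ^ (-(3 / 2 : ℝ)) = s⁻¹ * w⁻¹ := by
    rw [show (-(3 / 2 : ℝ)) = -(1 / 2 : ℝ) + (-1 : ℝ) by norm_num, Real.rpow_add hw, Real.rpow_neg_one,
      Real.rpow_neg hw.le]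
  rw [e3, e4, ← hs2]
  field_simp
  ring

/-- **Louboutin's fold.** For `Q ≥ 1`:
`∫₁^∞ T(y/Q)(y^{−1/2} + y^{−1}) dy ≤ (Q^{1/2} + 1) µ + ½ (Q^{1/2} − 1) log Q`
— Theorem 23 (45)/(47) with `f₂ = ζ`, `d = Q^{1/2}`: `|I_{f₁}(1)| ≤ (d + 1) I_ζ(1) + (d − 1) log d`
(after `y = x²`; the left side is the majorant `∫₁^∞ S_ζ(x/d)(1 + 1/x) dx` of (51)–(52)).
[cite: Louboutin2001CJM, Thm 23 (45) p. 1210 / proof p. 1211] -/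
theorem fold {Q : ℝ} (hQ : 1 ≤ Q) :
    ∫ y in Ioi 1, thetaMajor (y / Q) * weight y ≤
      (Q ^ (1 / 2 : ℝ) + 1) * mu + (Q ^ (1 / 2 : ℝ) - 1) / 2 * Real.log Q := by
  have hQ0 : 0 < Q := by linarith
  have hQi : 0 < Q⁻¹ := inv_pos.mpr hQ0
  set d : ℝ := Q ^ (1 / 2 : ℝ) with hd
  have hd1 : 1 ≤ d := Real.one_le_rpow hQ (by norm_num)
  -- the scaled weight
  set W : ℝ → ℝ := fun v ↦ d * v ^ (-(1 / 2 : ℝ)) + v⁻¹ with hW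
  have hWcont : ContinuousOn W (Ioi 0) := by
    refine ContinuousOn.add (ContinuousOn.mul continuousOn_const
      (continuousOn_id.rpow_const fun x hx ↦ Or.inl (ne_of_gt hx)))
      (continuousOn_inv₀.mono fun x (hx : 0 < x) ↦ hx.ne')
  have hWbd : ∀ v, Q⁻¹ < v → |W v| ≤ d * Q ^ (1 / 2 : ℝ) + Q := by
    intro v hv
    have hv0 : 0 < v := hQi.trans hv
    have hWv : 0 ≤ W v := by simp only [hW]; positivity
    rw [abs_of_nonneg hWv]
    have h1 : v ^ (-(1 / 2 : ℝ)) ≤ Q ^ (1 / 2 : ℝ) := by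
      have : v ^ (-(1 / 2 : ℝ)) ≤ (Q⁻¹) ^ (-(1 / 2 : ℝ)) :=
        Real.rpow_le_rpow_of_nonpos hQi hv.le (by norm_num)
      rwa [Real.inv_rpow hQ0.le, ← Real.rpow_neg hQ0.le, neg_neg] at this
    have h2 : v⁻¹ ≤ Q := by
      rw [← inv_inv Q]; exact inv_anti₀ hQi hv.le
    have : d * v ^ (-(1 / 2 : ℝ)) ≤ d * Q ^ (1 / 2 : ℝ) := mul_le_mul_of_nonneg_left h1 (by linarith)
    simp only [hW]; linarith
  have hTW : IntegrableOn (fun v ↦ thetaMajor v * W v) (Ioi Q⁻¹) :=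
    integrableOn_thetaMajor_mul hQi hWcont hWbd
  -- Step 1: scaling `y = Q v`
  have step1 : ∫ y in Ioi 1, thetaMajor (y / Q) * weight y = ∫ v in Ioi Q⁻¹, thetaMajor v * W v := by
    have h := integral_comp_mul_left_Ioi (fun v ↦ thetaMajor v * (Q * weight (Q * v))) 1 hQi
    rw [mul_one] at h
    have lhs : (fun y ↦ thetaMajor (y / Q) * weight y) =
        fun y ↦ Q⁻¹ * (thetaMajor (Q⁻¹ * y) * (Q * weight (Q * (Q⁻¹ * y)))) := by
      funext y
      rw [← mul_assoc Q, mul_inv_cancel₀ hQ0.ne', one_mul, div_eq_inv_mul]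
      field_simp
    rw [lhs, integral_const_mul, h, smul_eq_mul, inv_inv, ← mul_assoc, inv_mul_cancel₀ hQ0.ne', one_mul]
    refine setIntegral_congr_fun measurableSet_Ioi fun v (hv : Q⁻¹ < v) ↦ ?_
    simp only [hW, hd]
    rw [mul_weight_mul hQ0 (hQi.trans hv)]
  -- Step 2: split at `v = 1`
  have hsplit : Ioi Q⁻¹ = Ioc Q⁻¹ 1 ∪ Ioi 1 :=
    (Ioc_union_Ioi_eq_Ioi (inv_le_one_of_one_le₀ hQ)).symm
  have step2 : ∫ v in Ioi Q⁻¹, thetaMajor v * W v =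
      (∫ v in Ioc Q⁻¹ 1, thetaMajor v * W v) + ∫ v in Ioi 1, thetaMajor v * W v := by
    rw [hsplit]
    exact setIntegral_union (Set.disjoint_left.mpr fun x hx hx' ↦ (not_lt.mpr hx.2) hx')
      measurableSet_Ioi (hTW.mono_set (by rw [hsplit]; exact subset_union_left))
      (hTW.mono_set (by rw [hsplit]; exact subset_union_right))
  -- the two basic integrals
  set A : ℝ := ∫ v in Ioi 1, thetaMajor v * v ^ (-(1 / 2 : ℝ)) with hA
  set B : ℝ := ∫ v in Ioi 1, thetaMajor v * v⁻¹ with hB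
  have hIA := integrableOn_thetaMajor_mul_rpow (-(1 / 2 : ℝ)) (by norm_num)
  have hIB : IntegrableOn (fun v ↦ thetaMajor v * v⁻¹) (Ioi 1) := by
    have := integrableOn_thetaMajor_mul_rpow (-1) (by norm_num)
    refine this.congr_fun (fun v (hv : 1 < v) ↦ ?_) measurableSet_Ioi
    simp only [Real.rpow_neg_one]
  have hmuAB : mu = A + B := mu_eq_add
  -- Step 3: the tail `∫_1^∞ T W = d A + B`
  have step3 : ∫ v in Ioi 1, thetaMajor v * W v = d * A + B := by
    have : (fun v ↦ thetaMajor v * W v) = fun v ↦ d * (thetaMajor v * v ^ (-(1 / 2 : ℝ))) + thetaMajor v * v⁻¹ := by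
      funext v; simp only [hW]; ring
    rw [this, integral_add (hIA.const_mul d) hIB, integral_const_mul]
  -- Step 4: the bulk `∫_{1/Q}^1 T W`, folded onto `(1, Q)` by `v = 1/w`
  have step4 : ∫ v in Ioc Q⁻¹ 1, thetaMajor v * W v =
      ∫ w in (1 : ℝ)..Q, thetaMajor (1 / w) * (d * (1 / w) ^ (-(1 / 2 : ℝ)) + (1 / w)⁻¹) * (w ^ 2)⁻¹ := by
    rw [← intervalIntegral.integral_of_le (inv_le_one_of_one_le₀ hQ)]
    -- substitution `v = f w = w⁻¹` on `[1, Q]`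
    have hderiv : ∀ x ∈ Set.uIcc (1 : ℝ) Q, HasDerivAt (fun w : ℝ ↦ w⁻¹) (-(x ^ 2)⁻¹) x := by
      intro x hx
      rw [Set.uIcc_of_le hQ] at hx
      exact hasDerivAt_inv (by linarith [hx.1])
    have hcont : ContinuousOn (fun x : ℝ ↦ -(x ^ 2)⁻¹) (Set.uIcc (1 : ℝ) Q) := by
      refine ContinuousOn.neg (ContinuousOn.inv₀ (continuousOn_pow 2) fun x hx ↦ ?_)
      rw [Set.uIcc_of_le hQ] at hx
      exact pow_ne_zero 2 (by linarith [hx.1])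
    have himg : (fun w : ℝ ↦ w⁻¹) '' Set.uIcc (1 : ℝ) Q ⊆ Ioi 0 := by
      rintro _ ⟨x, hx, rfl⟩
      rw [Set.uIcc_of_le hQ] at hx
      have hx0 : (0 : ℝ) < x := by linarith [hx.1]
      simpa only [mem_Ioi] using inv_pos.mpr hx0
    have hg : ContinuousOn (fun v ↦ thetaMajor v * W v) ((fun w : ℝ ↦ w⁻¹) '' Set.uIcc (1 : ℝ) Q) :=
      ((continuousOn_thetaMajor.mul hWcont).mono himg)
    have hsub := intervalIntegral.integral_comp_mul_deriv' hderiv hcont hg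
    -- hsub : ∫ x in 1..Q, ((T·W) ∘ inv) x * (-(x^2)⁻¹) = ∫ v in 1⁻¹..Q⁻¹, T v * W v
    rw [inv_one] at hsub
    rw [intervalIntegral.integral_symm, ← hsub, ← intervalIntegral.integral_neg]
    refine intervalIntegral.integral_congr fun w _ ↦ ?_
    simp only [Function.comp_apply, hW, one_div]
    ring
  -- Step 5: evaluate the folded integral
  have hfold_pt : ∀ w ∈ Set.uIcc (1 : ℝ) Q,
      thetaMajor (1 / w) * (d * (1 / w) ^ (-(1 / 2 : ℝ)) + (1 / w)⁻¹) * (w ^ 2)⁻¹ =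
        thetaMajor w * (d * w⁻¹ + w ^ (-(1 / 2 : ℝ))) +
        (1 / 2 : ℝ) * (d * w⁻¹ + w ^ (-(1 / 2 : ℝ)) - d * w ^ (-(3 / 2 : ℝ)) - w⁻¹) := by
    intro w hw
    rw [Set.uIcc_of_le hQ] at hw
    exact folded_integrand (by linarith [hw.1])
  have h0 : (0 : ℝ) ∉ Set.uIcc (1 : ℝ) Q := by
    rw [Set.uIcc_of_le hQ]; intro h; exact absurd h.1 (by norm_num)
  -- integrability on [1, Q] of the two pieces
  have hTcont : ContinuousOn (fun w ↦ thetaMajor w * (d * w⁻¹ + w ^ (-(1 / 2 : ℝ)))) (Set.uIcc (1 : ℝ) Q) := by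
    refine (continuousOn_thetaMajor.mul (ContinuousOn.add (ContinuousOn.mul continuousOn_const
      (continuousOn_inv₀.mono fun x (hx : 0 < x) ↦ hx.ne'))
      (continuousOn_id.rpow_const fun x hx ↦ Or.inl (ne_of_gt hx)))).mono ?_
    intro x hx; rw [Set.uIcc_of_le hQ] at hx; exact (show (0 : ℝ) < x by linarith [hx.1])
  have hI1 : IntervalIntegrable (fun w ↦ thetaMajor w * (d * w⁻¹ + w ^ (-(1 / 2 : ℝ)))) volume 1 Q :=
    hTcont.intervalIntegrable
  have hc1 : IntervalIntegrable (fun w : ℝ ↦ w⁻¹) volume 1 Q :=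
    intervalIntegral.intervalIntegrable_inv (fun x hx ↦ by
      rw [Set.uIcc_of_le hQ] at hx; exact (show (0 : ℝ) < x by linarith [hx.1]).ne') continuousOn_id
  have hc2 : IntervalIntegrable (fun w : ℝ ↦ w ^ (-(1 / 2 : ℝ))) volume 1 Q :=
    intervalIntegral.intervalIntegrable_rpow (Or.inr h0)
  have hc3 : IntervalIntegrable (fun w : ℝ ↦ w ^ (-(3 / 2 : ℝ))) volume 1 Q :=
    intervalIntegral.intervalIntegrable_rpow (Or.inr h0)
  have hI2 : IntervalIntegrable
      (fun w : ℝ ↦ d * w⁻¹ + w ^ (-(1 / 2 : ℝ)) - d * w ^ (-(3 / 2 : ℝ)) - w⁻¹) volume 1 Q :=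
    (((hc1.const_mul _).add hc2).sub (hc3.const_mul _)).sub hc1
  have step5 : ∫ w in (1 : ℝ)..Q, thetaMajor (1 / w) * (d * (1 / w) ^ (-(1 / 2 : ℝ)) + (1 / w)⁻¹) * (w ^ 2)⁻¹
      = (∫ w in (1 : ℝ)..Q, thetaMajor w * (d * w⁻¹ + w ^ (-(1 / 2 : ℝ)))) + (d - 1) / 2 * Real.log Q := by
    rw [intervalIntegral.integral_congr hfold_pt, intervalIntegral.integral_add hI1 (hI2.const_mul _),
      intervalIntegral.integral_const_mul, integral_hTerms hQ]
    ring
  -- Step 6: bound the `T`-part of the folded integral by `d B + A`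
  have step6 : ∫ w in (1 : ℝ)..Q, thetaMajor w * (d * w⁻¹ + w ^ (-(1 / 2 : ℝ))) ≤ d * B + A := by
    rw [intervalIntegral.integral_of_le hQ]
    have hI : IntegrableOn (fun w ↦ thetaMajor w * (d * w⁻¹ + w ^ (-(1 / 2 : ℝ)))) (Ioi 1) := by
      have : (fun w ↦ thetaMajor w * (d * w⁻¹ + w ^ (-(1 / 2 : ℝ)))) =
          fun w ↦ d * (thetaMajor w * w⁻¹) + thetaMajor w * w ^ (-(1 / 2 : ℝ)) := by
        funext w; ring
      rw [this]; exact (hIB.const_mul d).add hIA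
    calc ∫ w in Ioc 1 Q, thetaMajor w * (d * w⁻¹ + w ^ (-(1 / 2 : ℝ)))
        ≤ ∫ w in Ioi 1, thetaMajor w * (d * w⁻¹ + w ^ (-(1 / 2 : ℝ))) := by
          refine setIntegral_mono_set hI ?_ (ae_of_all _ Ioc_subset_Ioi_self)
          refine (ae_restrict_iff' measurableSet_Ioi).mpr (ae_of_all _ fun w (hw : 1 < w) ↦ ?_)
          have : 0 < w := by linarith
          exact mul_nonneg (thetaMajor_nonneg w) (by positivity)
      _ = d * B + A := by
          have : (fun w ↦ thetaMajor w * (d * w⁻¹ + w ^ (-(1 / 2 : ℝ)))) =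
              fun w ↦ d * (thetaMajor w * w⁻¹) + thetaMajor w * w ^ (-(1 / 2 : ℝ)) := by
            funext w; ring
          rw [this, integral_add (hIB.const_mul d) hIA, integral_const_mul]
  -- assemble
  rw [step1, step2, step3, step4, step5, hmuAB]
  nlinarith [step6, mul_nonneg (by linarith : (0 : ℝ) ≤ d - 1) (le_refl (0:ℝ))]


/-! ### The split-and-fold bound for a theta-type Mellin integral (Theorem 21/23 at `β = 1`) -/

/-- `y ↦ T(y/Q) y^r` (`r ≤ 0`) is integrable on `(1, ∞)`. [folklore] -/
private theorem integrableOn_thetaMajor_div_mul_rpow {Q : ℝ} (hQ : 0 < Q) (r : ℝ) (hr : r ≤ 0) :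
    IntegrableOn (fun y ↦ thetaMajor (y / Q) * y ^ r) (Ioi 1) := by
  have hQi : 0 < Q⁻¹ := inv_pos.mpr hQ
  have key : IntegrableOn (fun v ↦ thetaMajor v * (Q * v) ^ r) (Ioi (Q⁻¹ * 1)) := by
    rw [mul_one]
    refine integrableOn_thetaMajor_mul (B := 1) hQi ?_ fun v hv ↦ ?_
    · exact (continuousOn_const.mul continuousOn_id).rpow_const fun x hx ↦
        Or.inl (mul_pos hQ hx).ne'
    · have hv0 : 0 < v := hQi.trans hv
      rw [abs_of_nonneg (Real.rpow_nonneg (mul_pos hQ hv0).le _)]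
      refine Real.rpow_le_one_of_one_le_of_nonpos ?_ hr
      have := mul_lt_mul_of_pos_left hv hQ
      rw [mul_inv_cancel₀ hQ.ne'] at this
      exact this.le
  have h := (integrableOn_Ioi_comp_mul_left_iff (fun v ↦ thetaMajor v * (Q * v) ^ r) 1 hQi).mpr key
  refine h.congr_fun (fun y _ ↦ ?_) measurableSet_Ioi
  show thetaMajor (Q⁻¹ * y) * (Q * (Q⁻¹ * y)) ^ r = thetaMajor (y / Q) * y ^ r
  rw [← mul_assoc, mul_inv_cancel₀ hQ.ne', one_mul, div_eq_inv_mul]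

/-- **Split at `y = 1`, fold `(0,1)` by the transformation formula, bound by the majorant**
(Louboutin's (43) + (51)–(52) at `β = 1`, in the variable `y = x²`): if `|Θ(y)|, |Θ'(y)| ≤ 2T(y/Q)`,
`Θ(y) = ε y^{−1/2} Θ'(1/y)` with `|ε| ≤ 1`, then
`|∫₀^∞ y^{−1/2} Θ(y) dy| ≤ 2 ∫₁^∞ T(y/Q) (y^{−1/2} + y^{−1}) dy`. [cite: Louboutin2001CJM, Thm 21 (43) p. 1209 / (51) p. 1211] -/
theorem norm_integral_le_majorant {Q : ℝ} (hQ : 0 < Q) {Θ Θ' : ℝ → ℂ} {ε : ℂ} (hε : ‖ε‖ ≤ 1)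
    (hΘ : ∀ y, 0 < y → ‖Θ y‖ ≤ 2 * thetaMajor (y / Q))
    (hΘ' : ∀ y, 0 < y → ‖Θ' y‖ ≤ 2 * thetaMajor (y / Q))
    (htrans : ∀ y, 0 < y → Θ y = ε * ((y ^ (-(1 / 2 : ℝ)) : ℝ) : ℂ) * Θ' (1 / y))
    (hint : IntegrableOn (fun y ↦ ((y ^ (-(1 / 2 : ℝ)) : ℝ) : ℂ) * Θ y) (Ioi 0)) :
    ‖∫ y in Ioi 0, ((y ^ (-(1 / 2 : ℝ)) : ℝ) : ℂ) * Θ y‖ ≤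
      2 * ∫ y in Ioi 1, thetaMajor (y / Q) * weight y := by
  set F : ℝ → ℂ := fun y ↦ ((y ^ (-(1 / 2 : ℝ)) : ℝ) : ℂ) * Θ y with hF
  -- split `(0, ∞) = (0, 1] ∪ (1, ∞)`
  have hsplit : Ioi (0 : ℝ) = Ioc 0 1 ∪ Ioi 1 := (Ioc_union_Ioi_eq_Ioi zero_le_one).symm
  have hdisj : Disjoint (Ioc (0 : ℝ) 1) (Ioi 1) :=
    Set.disjoint_left.mpr fun x hx hx' ↦ (not_lt.mpr hx.2) hx'
  have hI1 : IntegrableOn F (Ioc 0 1) := hint.mono_set Ioc_subset_Ioi_self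
  have hI2 : IntegrableOn F (Ioi 1) := hint.mono_set (Ioi_subset_Ioi zero_le_one)
  have e0 : ∫ y in Ioi 0, F y = (∫ y in Ioc 0 1, F y) + ∫ y in Ioi 1, F y := by
    rw [hsplit]; exact setIntegral_union hdisj measurableSet_Ioi hI1 hI2
  -- the piece over `(1, ∞)`
  have hmaj1 : IntegrableOn (fun y ↦ 2 * (thetaMajor (y / Q) * y ^ (-(1 / 2 : ℝ)))) (Ioi 1) :=
    (integrableOn_thetaMajor_div_mul_rpow hQ _ (by norm_num)).const_mul 2
  have b2 : ‖∫ y in Ioi 1, F y‖ ≤ ∫ y in Ioi 1, 2 * (thetaMajor (y / Q) * y ^ (-(1 / 2 : ℝ))) := by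
    refine norm_integral_le_of_norm_le hmaj1 ?_
    refine (ae_restrict_iff' measurableSet_Ioi).mpr (ae_of_all _ fun y (hy : 1 < y) ↦ ?_)
    have hy0 : 0 < y := by linarith
    rw [hF, norm_mul, Complex.norm_real, Real.norm_eq_abs, abs_of_nonneg (Real.rpow_nonneg hy0.le _)]
    have := hΘ y hy0
    have hr : 0 ≤ y ^ (-(1 / 2 : ℝ)) := Real.rpow_nonneg hy0.le _
    nlinarith
  -- the piece over `(0, 1]`, folded onto `(1, ∞)` by `y = 1/x`
  have e1 : ∫ y in Ioc 0 1, F y = ε * ∫ x in Ioi 1, ((x⁻¹ : ℝ) : ℂ) * Θ' x := by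
    have hsub := integral_comp_rpow_Ioi ((Ioc (0 : ℝ) 1).indicator F) (p := -1) (by norm_num)
    rw [setIntegral_indicator measurableSet_Ioc,
      show Ioi (0 : ℝ) ∩ Ioc 0 1 = Ioc 0 1 from Set.inter_eq_right.mpr Ioc_subset_Ioi_self] at hsub
    rw [← hsub]
    -- identify the integrand on `(0, ∞)` with the indicator of `[1, ∞)` of `ε x⁻¹ Θ'(x)`
    have hpt : ∀ x ∈ Ioi (0 : ℝ), (|(-1 : ℝ)| * x ^ ((-1 : ℝ) - 1)) • (Ioc (0 : ℝ) 1).indicator F (x ^ (-1 : ℝ))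
        = (Ici (1 : ℝ)).indicator (fun x ↦ ε * (((x⁻¹ : ℝ) : ℂ) * Θ' x)) x := by
      intro x hx
      have hx0 : 0 < x := hx
      rw [Real.rpow_neg_one]
      by_cases h1 : 1 ≤ x
      · have hmem : x⁻¹ ∈ Ioc (0 : ℝ) 1 := ⟨inv_pos.mpr hx0, inv_le_one_of_one_le₀ h1⟩
        rw [indicator_of_mem hmem, indicator_of_mem (show x ∈ Ici (1 : ℝ) from h1), hF]
        simp only
        have e1 : (x⁻¹) ^ (-(1 / 2 : ℝ)) = x ^ (1 / 2 : ℝ) := by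
          rw [Real.inv_rpow hx0.le, ← Real.rpow_neg hx0.le, neg_neg]
        have e3 : (1 : ℝ) / x⁻¹ = x := by rw [one_div, inv_inv]
        rw [htrans x⁻¹ (inv_pos.mpr hx0), e3, e1, abs_neg, abs_one, one_mul,
          show ((-1 : ℝ) - 1) = -2 by norm_num]
        have e2 : x ^ (-2 : ℝ) * x ^ (1 / 2 : ℝ) * x ^ (1 / 2 : ℝ) = x⁻¹ := by
          rw [← Real.rpow_add hx0, ← Real.rpow_add hx0, ← Real.rpow_neg_one]; norm_num
        rw [Complex.real_smul]
        have e2c : ((x ^ (-2 : ℝ) : ℝ) : ℂ) * ((x ^ (1 / 2 : ℝ) : ℝ) : ℂ) * ((x ^ (1 / 2 : ℝ) : ℝ) : ℂ) =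
            ((x⁻¹ : ℝ) : ℂ) := by
          rw [← Complex.ofReal_mul, ← Complex.ofReal_mul, e2]
        linear_combination (ε * Θ' x : ℂ) * e2c
      · push Not at h1
        have hnmem : x⁻¹ ∉ Ioc (0 : ℝ) 1 := fun h ↦ by
          have := h.2; rw [inv_le_one_iff₀] at this
          rcases this with h' | h' <;> linarith
        rw [indicator_of_notMem hnmem, indicator_of_notMem (show x ∉ Ici (1 : ℝ) from not_le.mpr h1),
          smul_zero]
    rw [setIntegral_congr_fun measurableSet_Ioi hpt, setIntegral_indicator measurableSet_Ici,
      show Ioi (0 : ℝ) ∩ Ici 1 = Ici 1 from Set.inter_eq_right.mpr fun x (hx : 1 ≤ x) ↦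
        (show (0 : ℝ) < x by exact lt_of_lt_of_le one_pos hx),
      integral_Ici_eq_integral_Ioi, integral_const_mul]
  have hmaj2 : IntegrableOn (fun y ↦ 2 * (thetaMajor (y / Q) * y⁻¹)) (Ioi 1) := by
    have h2 : IntegrableOn (fun y ↦ 2 * (thetaMajor (y / Q) * y ^ (-1 : ℝ))) (Ioi 1) :=
      (integrableOn_thetaMajor_div_mul_rpow hQ (-1) (by norm_num)).const_mul 2
    refine h2.congr_fun (fun y _ ↦ ?_) measurableSet_Ioi
    simp only [Real.rpow_neg_one]
  have b1 : ‖∫ y in Ioc 0 1, F y‖ ≤ ∫ y in Ioi 1, 2 * (thetaMajor (y / Q) * y⁻¹) := by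
    rw [e1, norm_mul]
    have hn : ‖∫ x in Ioi 1, ((x⁻¹ : ℝ) : ℂ) * Θ' x‖ ≤ ∫ y in Ioi 1, 2 * (thetaMajor (y / Q) * y⁻¹) := by
      refine norm_integral_le_of_norm_le hmaj2 ?_
      refine (ae_restrict_iff' measurableSet_Ioi).mpr (ae_of_all _ fun y (hy : 1 < y) ↦ ?_)
      have hy0 : 0 < y := by linarith
      rw [norm_mul, Complex.norm_real, Real.norm_eq_abs, abs_of_nonneg (inv_pos.mpr hy0).le]
      have := hΘ' y hy0
      have hr : 0 ≤ y⁻¹ := (inv_pos.mpr hy0).le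
      nlinarith
    have h0 : 0 ≤ ∫ y in Ioi 1, 2 * (thetaMajor (y / Q) * y⁻¹) :=
      setIntegral_nonneg measurableSet_Ioi fun y (hy : 1 < y) ↦ by
        have : 0 < y := by linarith
        exact mul_nonneg zero_le_two (mul_nonneg (thetaMajor_nonneg _) (inv_pos.mpr this).le)
    calc ‖ε‖ * ‖∫ x in Ioi 1, ((x⁻¹ : ℝ) : ℂ) * Θ' x‖ ≤ 1 * ∫ y in Ioi 1, 2 * (thetaMajor (y / Q) * y⁻¹) :=
          mul_le_mul hε hn (norm_nonneg _) zero_le_one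
      _ = _ := one_mul _
  -- assemble
  have esum : (∫ y in Ioi 1, 2 * (thetaMajor (y / Q) * y⁻¹)) +
      (∫ y in Ioi 1, 2 * (thetaMajor (y / Q) * y ^ (-(1 / 2 : ℝ)))) =
      2 * ∫ y in Ioi 1, thetaMajor (y / Q) * weight y := by
    rw [← integral_add hmaj2 hmaj1, ← integral_const_mul]
    refine setIntegral_congr_fun measurableSet_Ioi fun y _ ↦ ?_
    simp only [weight]; ring
  calc ‖∫ y in Ioi 0, F y‖ = ‖(∫ y in Ioc 0 1, F y) + ∫ y in Ioi 1, F y‖ := by rw [e0]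
    _ ≤ ‖∫ y in Ioc 0 1, F y‖ + ‖∫ y in Ioi 1, F y‖ := norm_add_le _ _
    _ ≤ (∫ y in Ioi 1, 2 * (thetaMajor (y / Q) * y⁻¹)) +
        ∫ y in Ioi 1, 2 * (thetaMajor (y / Q) * y ^ (-(1 / 2 : ℝ))) := add_le_add b1 b2
    _ = 2 * ∫ y in Ioi 1, thetaMajor (y / Q) * weight y := esum


/-! ### Even primitive Dirichlet characters: `√f · |L(1, χ)| ≤ (√f + 1) µ_ℚ + ½(√f − 1) log f` -/

section Dirichlet

open DirichletCharacter DirichletTheta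

variable {q : ℕ} [NeZero q]

/-- The Gaussian majorant of the theta series of an even character:
`|ϑ₀(y, χ)| ≤ 2 Σ_{n≥1} e^{−πn²y/q} = 2T(y/q)` (`q > 1`, `y > 0`) — Louboutin's `|S_{f₁}(x)| ≤ S_{f₂}(x/d)`
with `f₂ = ζ`. [cite: Louboutin2001CJM, Thm 23 (proof) p. 1211] -/
theorem norm_dirichletTheta_zero_le (χ : DirichletCharacter ℂ q) (heven : χ.Even) (hq : q ≠ 1)
    {y : ℝ} (hy : 0 < y) :
    ‖dirichletTheta 0 χ y‖ ≤ 2 * thetaMajor (y / q) := by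
  have hq0 : (0 : ℝ) < q := by exact_mod_cast NeZero.pos q
  have hpar : χ (-1) = (-1) ^ (0 : ℕ) := by rw [pow_zero]; exact heven
  have h := hasSum_nat_dirichletTheta hpar hq hy
  have hT := (hasSum_thetaMajor (div_pos hy hq0)).mul_left 2
  rw [← h.tsum_eq]
  refine tsum_of_norm_bounded hT fun n ↦ ?_
  rw [norm_mul, Complex.norm_ofNat]
  refine mul_le_mul_of_nonneg_left ?_ zero_le_two
  unfold thetaTerm
  rw [norm_mul, norm_mul, pow_zero, norm_one, mul_one, Complex.norm_real, Real.norm_eq_abs,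
    abs_of_nonneg (Real.exp_pos _).le]
  have h1 : ‖χ (((n : ℤ) + 1 : ℤ) : ZMod q)‖ ≤ 1 := χ.norm_le_one _
  have h2 : rexp (-(π * (((n : ℤ) + 1 : ℤ) : ℝ) ^ 2 * y / q)) = rexp (-(π * ((n : ℝ) + 1) ^ 2 * (y / q))) := by
    push_cast; ring_nf
  rw [h2]
  exact mul_le_of_le_one_left (Real.exp_pos _).le h1

omit [NeZero q] in
/-- `χ̄ = χ⁻¹` is even when `χ` is. [folklore] -/
private theorem even_inv {χ : DirichletCharacter ℂ q} (heven : χ.Even) : χ⁻¹.Even := by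
  show χ⁻¹ (-1) = 1
  rw [MulChar.inv_apply_eq_inv', heven, inv_one]

/-- **Louboutin's bound, fold form** (Theorem 23 (45)/(47) with `f₁ = L(s, χ)`, `f₂ = ζ`, `d = √q`, at
`β = 1`, where `F_χ(1) = √q · L(1, χ)`): for an even primitive `χ ≠ 1` mod `q`,
`√q · |L(1, χ)| ≤ (√q + 1) µ_ℚ + ½ (√q − 1) log q`, i.e. Prop. 28's
`|I_{f₁}(1)| ≤ d(log d + µ_ℚ) + (µ_ℚ − log d)`. [cite: Louboutin2001CJM, Prop 28 p. 1219 / Thm 23 (47) p. 1210] -/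
theorem sqrt_mul_norm_LFunction_one_le (χ : DirichletCharacter ℂ q) (hprim : χ.IsPrimitive)
    (hχ : χ ≠ 1) (heven : χ.Even) :
    (q : ℝ) ^ (1 / 2 : ℝ) * ‖χ.LFunction 1‖ ≤
      ((q : ℝ) ^ (1 / 2 : ℝ) + 1) * mu + ((q : ℝ) ^ (1 / 2 : ℝ) - 1) / 2 * Real.log q := by
  have hq1 : q ≠ 1 := by rintro rfl; exact hχ χ.level_one
  have hq0 : (0 : ℝ) < q := by exact_mod_cast NeZero.pos q
  have hq1' : (1 : ℝ) ≤ q := by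
    have : 1 ≤ q := NeZero.one_le; exact_mod_cast this
  have hκ : charParity χ = 0 := charParity_of_even heven
  -- `ξ(1, χ) = ½ ∫₀^∞ y^{-1/2} ϑ₀(y, χ) dy`
  have hxi := dirichletXi_eq_mellin hχ 1
  rw [hκ, Nat.cast_zero, add_zero] at hxi
  have hmel : mellin (dirichletTheta 0 χ) (1 / 2) =
      ∫ y in Ioi 0, (((y ^ (-(1 / 2 : ℝ))) : ℝ) : ℂ) * dirichletTheta 0 χ y := by
    rw [mellin]
    refine setIntegral_congr_fun measurableSet_Ioi fun y (hy : 0 < y) ↦ ?_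
    rw [smul_eq_mul, show (1 / 2 : ℂ) - 1 = ((-(1 / 2) : ℝ) : ℂ) by push_cast; ring,
      Complex.ofReal_cpow hy.le]
  -- `ξ(1, χ) = L(1, χ) Γ(1/2) (q/π)^{1/2}`
  have hxiL := dirichletXi_eq_LFunction_mul hχ (s := 1) (fun n ↦ by
    rw [hκ, Nat.cast_zero, add_zero]
    intro h
    have := congrArg Complex.re h
    simp at this
    linarith)
  rw [hκ, Nat.cast_zero, add_zero] at hxiL
  have hnormxi : ‖dirichletXi χ 1‖ = (q : ℝ) ^ (1 / 2 : ℝ) * ‖χ.LFunction 1‖ := by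
    have e1 : ‖Complex.Gamma (1 / 2)‖ = π ^ (1 / 2 : ℝ) := by
      rw [Complex.Gamma_one_half_eq, Complex.norm_cpow_eq_rpow_re_of_pos Real.pi_pos]
      norm_num
    have e2 : ‖((q : ℂ) / π) ^ (1 / 2 : ℂ)‖ = ((q : ℝ) / π) ^ (1 / 2 : ℝ) := by
      rw [show ((q : ℂ) / π) = (((q : ℝ) / π : ℝ) : ℂ) by push_cast; rfl,
        Complex.norm_cpow_eq_rpow_re_of_pos (div_pos hq0 Real.pi_pos)]
      norm_num
    rw [hxiL, norm_mul, norm_mul, e1, e2, mul_assoc,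
      ← Real.mul_rpow Real.pi_pos.le (div_pos hq0 Real.pi_pos).le,
      mul_div_cancel₀ _ Real.pi_pos.ne', mul_comm]
  -- the split-and-fold bound
  have hmaj : ‖∫ y in Ioi 0, (((y ^ (-(1 / 2 : ℝ))) : ℝ) : ℂ) * dirichletTheta 0 χ y‖ ≤
      2 * ∫ y in Ioi 1, thetaMajor (y / q) * weight y := by
    refine norm_integral_le_majorant hq0 (Θ' := dirichletTheta 0 χ⁻¹) (ε := rootNumber χ)
      (le_of_eq (SelbergDirichlet.norm_rootNumber hprim))
      (fun y hy ↦ norm_dirichletTheta_zero_le χ heven hq1 hy)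
      (fun y hy ↦ norm_dirichletTheta_zero_le χ⁻¹ (even_inv heven) hq1 hy)
      (fun y hy ↦ ?_) ?_
    · have h := dirichletTheta_transformation hprim hy
      rw [hκ, Nat.cast_zero, add_zero] at h
      exact h
    · have h := mellinConvergent_dirichletTheta_zero hχ (1 / 2)
      rw [MellinConvergent] at h
      refine h.congr_fun (fun y (hy : 0 < y) ↦ ?_) measurableSet_Ioi
      show (y : ℂ) ^ ((1 : ℂ) / 2 - 1) • dirichletTheta 0 χ y = _
      rw [smul_eq_mul, show (1 / 2 : ℂ) - 1 = ((-(1 / 2) : ℝ) : ℂ) by push_cast; ring,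
        Complex.ofReal_cpow hy.le]
  have hchain : (q : ℝ) ^ (1 / 2 : ℝ) * ‖χ.LFunction 1‖ ≤ ∫ y in Ioi 1, thetaMajor (y / q) * weight y := by
    rw [← hnormxi, hxi, hmel, norm_mul]
    have : ‖(1 / 2 : ℂ)‖ = 1 / 2 := by norm_num
    rw [this]
    linarith
  exact hchain.trans (fold hq1')

/-- **Louboutin's (15), analytic form**: for an even primitive `χ ≠ 1` mod `q`,
`|L(1, χ)| ≤ ½ log q + µ_ℚ − (½ log q − µ_ℚ)/√q`. [cite: Louboutin2001CJM, Thm 7 (15) p. 1197 / Prop 28 p. 1219] -/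
theorem norm_LFunction_one_le_sub (χ : DirichletCharacter ℂ q) (hprim : χ.IsPrimitive)
    (hχ : χ ≠ 1) (heven : χ.Even) :
    ‖χ.LFunction 1‖ ≤ Real.log q / 2 + mu - (Real.log q / 2 - mu) / (q : ℝ) ^ (1 / 2 : ℝ) := by
  have hq0 : (0 : ℝ) < q := by exact_mod_cast NeZero.pos q
  have hd : 0 < (q : ℝ) ^ (1 / 2 : ℝ) := Real.rpow_pos_of_pos hq0 _
  have h := sqrt_mul_norm_LFunction_one_le χ hprim hχ heven
  have h2 : ‖χ.LFunction 1‖ ≤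
      (((q : ℝ) ^ (1 / 2 : ℝ) + 1) * mu + ((q : ℝ) ^ (1 / 2 : ℝ) - 1) / 2 * Real.log q) /
        (q : ℝ) ^ (1 / 2 : ℝ) := by
    rw [le_div_iff₀ hd]; linarith
  refine h2.trans (le_of_eq ?_)
  field_simp
  ring

/-- **Louboutin 2001, Theorem 7 (15), first inequality**: for an even primitive Dirichlet character
`χ` of conductor `f > 1`, `|L(1, χ)| ≤ ½ (log f + 2µ_ℚ)` — given `µ_ℚ ≤ ½ log f`
(`µ_ℚ = 0.023…`; discharged below). [cite: Louboutin2001CJM, Thm 7 (15) p. 1197] -/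
theorem norm_LFunction_one_le_of_mu_le (χ : DirichletCharacter ℂ q) (hprim : χ.IsPrimitive)
    (hχ : χ ≠ 1) (heven : χ.Even) (hmu : mu ≤ Real.log q / 2) :
    ‖χ.LFunction 1‖ ≤ (Real.log q + 2 * mu) / 2 := by
  have hq0 : (0 : ℝ) < q := by exact_mod_cast NeZero.pos q
  have hd : 0 < (q : ℝ) ^ (1 / 2 : ℝ) := Real.rpow_pos_of_pos hq0 _
  have h := norm_LFunction_one_le_sub χ hprim hχ heven
  have : 0 ≤ (Real.log q / 2 - mu) / (q : ℝ) ^ (1 / 2 : ℝ) := div_nonneg (by linarith) hd.le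
  linarith

end Dirichlet


/-! ### `µ_ℚ` is Louboutin's `lim_{s→1} (F_ℚ(s) − 1/(s(s−1)))`: `µ = Λ₀(1)` (Mathlib's `completedRiemannZeta₀ 1`) -/

/-- Change of variables `t = 1/x` from `(0, 1]` onto `(1, ∞)`. [folklore] -/
private theorem setIntegral_Ioc_eq_Ioi_inv (g : ℝ → ℝ) :
    ∫ t in Ioc (0 : ℝ) 1, g t = ∫ x in Ioi (1 : ℝ), (x ^ 2)⁻¹ * g x⁻¹ := by
  have hsub := integral_comp_rpow_Ioi ((Ioc (0 : ℝ) 1).indicator g) (p := -1) (by norm_num)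
  rw [setIntegral_indicator measurableSet_Ioc,
    show Ioi (0 : ℝ) ∩ Ioc 0 1 = Ioc 0 1 from Set.inter_eq_right.mpr Ioc_subset_Ioi_self] at hsub
  rw [← hsub]
  have hpt : ∀ x ∈ Ioi (0 : ℝ), (|(-1 : ℝ)| * x ^ ((-1 : ℝ) - 1)) • (Ioc (0 : ℝ) 1).indicator g (x ^ (-1 : ℝ))
      = (Ici (1 : ℝ)).indicator (fun x ↦ (x ^ 2)⁻¹ * g x⁻¹) x := by
    intro x hx
    have hx0 : 0 < x := hx
    rw [Real.rpow_neg_one, abs_neg, abs_one, one_mul, show ((-1 : ℝ) - 1) = -2 by norm_num, smul_eq_mul]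
    have e2 : x ^ (-2 : ℝ) = (x ^ 2)⁻¹ := by
      rw [Real.rpow_neg hx0.le, show (2 : ℝ) = ((2 : ℕ) : ℝ) by norm_num, Real.rpow_natCast]
    by_cases h1 : 1 ≤ x
    · have hmem : x⁻¹ ∈ Ioc (0 : ℝ) 1 := ⟨inv_pos.mpr hx0, inv_le_one_of_one_le₀ h1⟩
      rw [indicator_of_mem hmem, indicator_of_mem (show x ∈ Ici (1 : ℝ) from h1), e2]
    · push Not at h1
      have hnmem : x⁻¹ ∉ Ioc (0 : ℝ) 1 := fun h ↦ by
        have := h.2; rw [inv_le_one_iff₀] at this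
        rcases this with h' | h' <;> linarith
      rw [indicator_of_notMem hnmem, indicator_of_notMem (show x ∉ Ici (1 : ℝ) from not_le.mpr h1),
        mul_zero]
  rw [setIntegral_congr_fun measurableSet_Ioi hpt, setIntegral_indicator measurableSet_Ici,
    show Ioi (0 : ℝ) ∩ Ici 1 = Ici 1 from Set.inter_eq_right.mpr fun x (hx : 1 ≤ x) ↦
      (show (0 : ℝ) < x by exact lt_of_lt_of_le one_pos hx),
    integral_Ici_eq_integral_Ioi]

/-- Mathlib's modified kernel of the Riemann zeta FE-pair on `(1, ∞)`: `f_modif(t) = θ(t) − 1 = 2T(t)`. [folklore] -/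
private theorem f_modif_zero_of_one_lt {t : ℝ} (ht1 : 1 < t) :
    (hurwitzEvenFEPair 0).f_modif t = ((2 * thetaMajor t : ℝ) : ℂ) := by
  have hmem : t ∈ Ioi (1 : ℝ) := ht1
  have hnot : t ∉ Ioo (0 : ℝ) 1 := fun h ↦ (lt_asymm h.2 ht1).elim
  rw [WeakFEPair.f_modif, Pi.add_apply, indicator_of_mem hmem, indicator_of_notMem hnot, add_zero]
  show ((evenKernel 0 t : ℝ) : ℂ) - (if (0 : UnitAddCircle) = 0 then 1 else 0) = _
  rw [if_pos rfl, evenKernel_zero_eq (by linarith)]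
  push_cast; ring

/-- Mathlib's modified kernel on `(0, 1)`: `f_modif(t) = θ(t) − t^{−1/2} = 2 t^{−1/2} T(1/t)` (Jacobi). [folklore] -/
private theorem f_modif_zero_of_lt_one {t : ℝ} (ht : 0 < t) (ht1 : t < 1) :
    (hurwitzEvenFEPair 0).f_modif t = ((2 * t ^ (-(1 / 2 : ℝ)) * thetaMajor (1 / t) : ℝ) : ℂ) := by
  have hmem : t ∈ Ioo (0 : ℝ) 1 := ⟨ht, ht1⟩
  have hnot : t ∉ Ioi (1 : ℝ) := by simp [ht1.le]
  rw [WeakFEPair.f_modif, Pi.add_apply, indicator_of_notMem hnot, zero_add, indicator_of_mem hmem]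
  show ((evenKernel 0 t : ℝ) : ℂ) - ((1 : ℂ) * ((t ^ (-(1 / 2 : ℝ)) : ℝ) : ℂ)) • (1 : ℂ) = _
  have hfe := evenKernel_functional_equation 0 t
  rw [evenKernel_eq_cosKernel_of_zero.symm, evenKernel_zero_eq (by positivity : 0 < 1 / t)] at hfe
  rw [hfe, smul_eq_mul, mul_one, one_mul]
  have e : 1 / t ^ (1 / 2 : ℝ) = t ^ (-(1 / 2 : ℝ)) := by
    rw [Real.rpow_neg ht.le, one_div]
  rw [e]
  push_cast; ring

/-- **`µ_ℚ = Λ₀(1)`**: Louboutin's `µ_ℚ = lim_{s↓1} (F_ℚ(s) − 1/(s(s−1)))` with `F_ℚ(s) = π^{−s/2}Γ(s/2)ζ(s)`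
(§2.1 p. 1195, `λ_ℚ = 1`) is Mathlib's entire completed zeta `completedRiemannZeta₀` at `s = 1`
(`Λ(s) = Λ₀(s) − 1/s − 1/(1−s)`), and equals `I_ζ(1) = ∫₁^∞ S_ζ(x)(1 + 1/x) dx = ∫₁^∞ T(v)(v^{−1/2} + v^{−1}) dv`
((43)–(44) p. 1209 with Riemann's split of `∫₀^∞ (θ(t) − 1) t^{s/2} dt/t`). [cite: Louboutin2001CJM, §2.1 p. 1195 / (44) p. 1209] -/
theorem completedRiemannZeta₀_one_eq_mu : completedRiemannZeta₀ 1 = (mu : ℂ) := by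
  set P : WeakFEPair ℂ := hurwitzEvenFEPair 0 with hP
  have h1 : completedRiemannZeta₀ 1 = mellin P.f_modif (1 / 2) / 2 := by
    rw [completedRiemannZeta₀, completedHurwitzZetaEven₀]; rfl
  have hconv : MellinConvergent P.f_modif (1 / 2) := (P.isStrongFEPair_toStrongFEPair.hasMellin (1 / 2)).1
  rw [MellinConvergent] at hconv
  set G : ℝ → ℂ := fun t ↦ (t : ℂ) ^ ((1 / 2 : ℂ) - 1) • P.f_modif t with hG
  have hsplit : Ioi (0 : ℝ) = Ioc 0 1 ∪ Ioi 1 := (Ioc_union_Ioi_eq_Ioi zero_le_one).symm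
  have hdisj : Disjoint (Ioc (0 : ℝ) 1) (Ioi 1) :=
    Set.disjoint_left.mpr fun x hx hx' ↦ (not_lt.mpr hx.2) hx'
  have e0 : mellin P.f_modif (1 / 2) = (∫ t in Ioc 0 1, G t) + ∫ t in Ioi 1, G t := by
    rw [mellin, ← hG, hsplit]
    exact setIntegral_union hdisj measurableSet_Ioi (hconv.mono_set Ioc_subset_Ioi_self)
      (hconv.mono_set (Ioi_subset_Ioi zero_le_one))
  have hcpow : ∀ t : ℝ, 0 < t → (t : ℂ) ^ ((1 / 2 : ℂ) - 1) = ((t ^ (-(1 / 2 : ℝ)) : ℝ) : ℂ) := by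
    intro t ht
    rw [show (1 / 2 : ℂ) - 1 = ((-(1 / 2) : ℝ) : ℂ) by push_cast; ring, Complex.ofReal_cpow ht.le]
  -- the piece over `(1, ∞)`
  have e1 : ∫ t in Ioi 1, G t = ((∫ t in Ioi (1 : ℝ), 2 * (thetaMajor t * t ^ (-(1 / 2 : ℝ))) : ℝ) : ℂ) := by
    rw [← integral_complex_ofReal]
    refine setIntegral_congr_fun measurableSet_Ioi fun t (ht : 1 < t) ↦ ?_
    rw [hG]; simp only
    rw [hcpow t (by linarith), f_modif_zero_of_one_lt ht, smul_eq_mul]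
    push_cast; ring
  -- the piece over `(0, 1]`
  have e2 : ∫ t in Ioc 0 1, G t = ((∫ t in Ioi (1 : ℝ), 2 * (thetaMajor t * t⁻¹) : ℝ) : ℂ) := by
    have step : ∫ t in Ioc 0 1, G t = ((∫ t in Ioc (0 : ℝ) 1, 2 * t⁻¹ * thetaMajor (1 / t) : ℝ) : ℂ) := by
      rw [← integral_complex_ofReal, integral_Ioc_eq_integral_Ioo, integral_Ioc_eq_integral_Ioo]
      refine setIntegral_congr_fun measurableSet_Ioo fun t ht ↦ ?_
      rw [hG]; simp only
      rw [hcpow t ht.1, f_modif_zero_of_lt_one ht.1 ht.2, smul_eq_mul]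
      have e : t ^ (-(1 / 2 : ℝ)) * t ^ (-(1 / 2 : ℝ)) = t⁻¹ := by
        rw [← Real.rpow_add ht.1, ← Real.rpow_neg_one]; norm_num
      have ec : ((t ^ (-(1 / 2 : ℝ)) : ℝ) : ℂ) * ((t ^ (-(1 / 2 : ℝ)) : ℝ) : ℂ) = ((t⁻¹ : ℝ) : ℂ) := by
        rw [← Complex.ofReal_mul, e]
      simp only [Complex.ofReal_mul, Complex.ofReal_ofNat]
      linear_combination (2 * (thetaMajor (1 / t) : ℂ)) * ec
    rw [step, setIntegral_Ioc_eq_Ioi_inv]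
    congr 1
    refine setIntegral_congr_fun measurableSet_Ioi fun x (hx : 1 < x) ↦ ?_
    have hx0 : (x : ℝ) ≠ 0 := by positivity
    rw [one_div, inv_inv]
    field_simp
  have hIA := integrableOn_thetaMajor_mul_rpow (-(1 / 2 : ℝ)) (by norm_num)
  have hIB : IntegrableOn (fun v ↦ thetaMajor v * v⁻¹) (Ioi 1) := by
    have := integrableOn_thetaMajor_mul_rpow (-1) (by norm_num)
    refine this.congr_fun (fun v (_ : 1 < v) ↦ ?_) measurableSet_Ioi
    simp only [Real.rpow_neg_one]
  rw [h1, e0, e1, e2, mu_eq_add, integral_const_mul, integral_const_mul]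
  push_cast
  ring


/-! ### The closed form `µ_ℚ = (2 + γ − log 4π)/2 = 0.023095…` (p. 1195) -/

/-- **`Λ₀(1) = (2 + γ − log 4π)/2`**: Louboutin's «Notice that `µ_ℚ = (2 + γ − log(4π))/2 = 0.023095…`»
(p. 1195), from `ζ(s) = 1/(s−1) + γ + O(s−1)` (Mathlib `tendsto_riemannZeta_sub_one_div`) and
`Γ_ℝ'(1) = −(γ + log 4π)/2` (Mathlib `hasDerivAt_Gammaℝ_one`). [cite: Louboutin2001CJM, §2.1 p. 1195] -/
theorem completedRiemannZeta₀_one :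
    completedRiemannZeta₀ 1 = 1 + ((Real.eulerMascheroniConstant : ℂ) - (Real.log (4 * π) : ℂ)) / 2 := by
  -- continuity of `Λ₀` at `1`
  have hcont : Tendsto completedRiemannZeta₀ (𝓝[≠] 1) (𝓝 (completedRiemannZeta₀ 1)) :=
    (differentiable_completedZeta₀.continuous.tendsto 1).mono_left nhdsWithin_le_nhds
  -- the decomposition valid near `1`
  have hre : ∀ᶠ s : ℂ in 𝓝[≠] 1, 0 < s.re := by
    have : ∀ᶠ s : ℂ in 𝓝 1, 0 < s.re :=
      (Complex.continuous_re.tendsto 1).eventually (Ioi_mem_nhds (by simp))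
    exact this.filter_mono nhdsWithin_le_nhds
  have heq : ∀ᶠ s : ℂ in 𝓝[≠] 1, completedRiemannZeta₀ s =
      Gammaℝ s * (riemannZeta s - 1 / (s - 1)) + slope Gammaℝ 1 s + 1 / s := by
    filter_upwards [hre, self_mem_nhdsWithin] with s hs hs1
    have hs0 : s ≠ 0 := fun h ↦ by rw [h] at hs; simp at hs
    have hs1' : s - 1 ≠ 0 := sub_ne_zero.mpr hs1
    have h1s : 1 - s ≠ 0 := sub_ne_zero.mpr (Ne.symm hs1)
    have hG : Gammaℝ s ≠ 0 := Complex.Gammaℝ_ne_zero_of_re_pos hs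
    have hζ : Gammaℝ s * riemannZeta s = completedRiemannZeta s := by
      rw [riemannZeta_def_of_ne_zero hs0, mul_div_cancel₀ _ hG]
    rw [slope_def_field, Complex.Gammaℝ_one, mul_sub, hζ, completedRiemannZeta_eq]
    field_simp
    ring
  have hG1 : Tendsto Gammaℝ (𝓝[≠] (1 : ℂ)) (𝓝 1) := by
    have := (Complex.hasDerivAt_Gammaℝ_one.continuousAt.tendsto).mono_left
      (nhdsWithin_le_nhds (s := ({1}ᶜ : Set ℂ)))
    rwa [Complex.Gammaℝ_one] at this
  have h1s : Tendsto (fun s : ℂ ↦ 1 / s) (𝓝[≠] (1 : ℂ)) (𝓝 (1 / 1)) :=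
    ((continuousAt_const.div continuousAt_id one_ne_zero).tendsto).mono_left nhdsWithin_le_nhds
  have hlim : Tendsto (fun s ↦ Gammaℝ s * (riemannZeta s - 1 / (s - 1)) + slope Gammaℝ 1 s + 1 / s)
      (𝓝[≠] 1) (𝓝 (1 * (Real.eulerMascheroniConstant : ℂ) +
        (-((Real.eulerMascheroniConstant : ℂ) + Complex.log (4 * π)) / 2) + 1 / 1)) :=
    ((hG1.mul tendsto_riemannZeta_sub_one_div).add Complex.hasDerivAt_Gammaℝ_one.tendsto_slope).add h1s
  have := tendsto_nhds_unique (hcont.congr' heq) hlim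
  rw [this]
  have hlog : Complex.log (4 * π) = ((Real.log (4 * π) : ℝ) : ℂ) := by
    rw [Complex.ofReal_log (by positivity)]; push_cast; ring_nf
  rw [hlog]
  ring

/-- **`µ_ℚ = 1 + (γ − log 4π)/2 = (2 + γ − log 4π)/2`** (p. 1195). [cite: Louboutin2001CJM, §2.1 p. 1195] -/
theorem mu_eq : mu = 1 + (Real.eulerMascheroniConstant - Real.log (4 * π)) / 2 := by
  have h := completedRiemannZeta₀_one_eq_mu.symm.trans completedRiemannZeta₀_one
  exact_mod_cast h

/-- **`µ_ℚ < 0.0231`** (`µ_ℚ = 0.023095…`, p. 1195; from `γ < 0.57721571`, `log 2 > 0.6931471803`,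
`log π > 1.1447298858`). [cite: Louboutin2001CJM, §2.1 p. 1195] -/
theorem mu_lt : mu < 0.0231 := by
  rw [mu_eq]
  have hγ := Literature.Analysis.SpecialFunctions.Real.eulerMascheroniConstant_lt_d8
  have hπ := Literature.Analysis.SpecialFunctions.Real.log_pi_gt_d20
  have h2 := Real.log_two_gt_d9
  have hlog : Real.log (4 * π) = 2 * Real.log 2 + Real.log π := by
    rw [Real.log_mul (by norm_num) Real.pi_pos.ne', show (4 : ℝ) = 2 ^ 2 by norm_num, Real.log_pow]
    push_cast; ring
  rw [hlog]
  norm_num at hγ hπ h2 ⊢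
  linarith

/-- **`0.023 < µ_ℚ`** (two-sided check of the printed `0.023095…`). [cite: Louboutin2001CJM, §2.1 p. 1195] -/
theorem lt_mu : 0.023 < mu := by
  rw [mu_eq]
  have hγ := Literature.Analysis.SpecialFunctions.Real.eulerMascheroniConstant_gt_d8
  have hπ := Literature.Analysis.SpecialFunctions.Real.log_pi_lt_d20
  have h2 := Real.log_two_lt_d9
  have hlog : Real.log (4 * π) = 2 * Real.log 2 + Real.log π := by
    rw [Real.log_mul (by norm_num) Real.pi_pos.ne', show (4 : ℝ) = 2 ^ 2 by norm_num, Real.log_pow]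
    push_cast; ring
  rw [hlog]
  norm_num at hγ hπ h2 ⊢
  linarith

/-! ### Theorem 7 (15), unconditional forms -/

section Main

open DirichletCharacter

variable {q : ℕ} [NeZero q]

/-- **Louboutin 2001, Theorem 7 (15)** — «Let `χ` be an even primitive Dirichlet character modulo
`f_χ > 1`. Then `|L(1, χ)| ≤ ½ (log f_χ + 2µ_ℚ)`», with `µ_ℚ = (2 + γ − log 4π)/2` (p. 1195), i.e.
**`|L(1, χ)| ≤ ½ log f_χ + (2 + γ − log 4π)/2`** (Louboutin's `0.023…`, cf. Ramaré's named
`ramare2001_corollary1` with `+ 0`). Typed for `χ` primitive mod `q`, `χ ≠ 1`, `χ(−1) = 1`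
(`f_χ = q > 1`). [cite: Louboutin2001CJM, Thm 7 (15) p. 1197] -/
theorem norm_LFunction_one_le (χ : DirichletCharacter ℂ q) (hprim : χ.IsPrimitive)
    (hχ : χ ≠ 1) (heven : χ.Even) :
    ‖χ.LFunction 1‖ ≤
      Real.log q / 2 + (2 + Real.eulerMascheroniConstant - Real.log (4 * π)) / 2 := by
  have hq1 : q ≠ 1 := by rintro rfl; exact hχ χ.level_one
  have hq2 : (2 : ℝ) ≤ q := by
    have h0 := NeZero.ne q
    have : 2 ≤ q := by omega
    exact_mod_cast this
  have hmu : mu ≤ Real.log q / 2 := by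
    have h1 := mu_lt
    have h2 : Real.log 2 ≤ Real.log q := Real.log_le_log two_pos hq2
    have h3 := Real.log_two_gt_d9
    norm_num at h1 h3 ⊢
    linarith
  have h := norm_LFunction_one_le_of_mu_le χ hprim hχ heven hmu
  rw [mu_eq] at h
  linarith

/-- **Louboutin 2001, Theorem 7 (15), second inequality as printed**: `|L(1, χ)| ≤ ½ (log f_χ + 0.05)`
for every even primitive Dirichlet character of conductor `f_χ > 1`. [cite: Louboutin2001CJM, Thm 7 (15) p. 1197] -/
theorem norm_LFunction_one_le_half_log_add (χ : DirichletCharacter ℂ q) (hprim : χ.IsPrimitive)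
    (hχ : χ ≠ 1) (heven : χ.Even) :
    ‖χ.LFunction 1‖ ≤ (Real.log q + 0.05) / 2 := by
  have hq1 : q ≠ 1 := by rintro rfl; exact hχ χ.level_one
  have hq2 : (2 : ℝ) ≤ q := by
    have h0 := NeZero.ne q
    have : 2 ≤ q := by omega
    exact_mod_cast this
  have h1 := mu_lt
  have hmu : mu ≤ Real.log q / 2 := by
    have h2 : Real.log 2 ≤ Real.log q := Real.log_le_log two_pos hq2
    have h3 := Real.log_two_gt_d9
    norm_num at h1 h3 ⊢
    linarith
  have h := norm_LFunction_one_le_of_mu_le χ hprim hχ heven hmu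
  norm_num at h1 ⊢
  linarith

/-- Decimal form for consumers: **`|L(1, χ)| ≤ ½ log q + 0.0231`** for every even primitive `χ ≠ 1`
mod `q` (Louboutin's `½ log q + 0.023…`; compare the tree's PROVED `DirichletAbel.norm_LFunction_one_le_log`
(`≤ log q`) and `norm_LFunction_one_le_half_log_add_loglog` (`≤ ½ log q + log log q + 2`, from
Pólya–Vinogradov)). [cite: Louboutin2001CJM, Thm 7 (15) p. 1197] -/
theorem norm_LFunction_one_le_half_log_add_d4 (χ : DirichletCharacter ℂ q) (hprim : χ.IsPrimitive)
    (hχ : χ ≠ 1) (heven : χ.Even) :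
    ‖χ.LFunction 1‖ ≤ Real.log q / 2 + 0.0231 := by
  have h := norm_LFunction_one_le_half_log_add χ hprim hχ heven
  have hq2 : (2 : ℝ) ≤ q := by
    have h0 := NeZero.ne q
    have hq1 : q ≠ 1 := by rintro rfl; exact hχ χ.level_one
    have : 2 ≤ q := by omega
    exact_mod_cast this
  have h1 := mu_lt
  have hmu : mu ≤ Real.log q / 2 := by
    have h2 : Real.log 2 ≤ Real.log q := Real.log_le_log two_pos hq2
    have h3 := Real.log_two_gt_d9
    norm_num at h1 h3 ⊢
    linarith
  have h' := norm_LFunction_one_le_of_mu_le χ hprim hχ heven hmu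
  norm_num at h1 ⊢
  linarith

end Main

/-! ### Even conductor: `|L(1, χ)| ≤ ¼ log f + (2 + γ − log π)/4` for even primitive `χ` with `2 ∣ f`
(appended; Louboutin's [Lou1] second inequality) -/

section EvenConductor

/-- **The fold from below**: for `Q ≥ 1`,
`(√Q + 1) µ_ℚ + ½(√Q − 1) log Q − Q^{−1/2} e^{−πQ} ≤ ∫₁^∞ T(y/Q)(y^{−1/2} + y^{−1}) dy` — the fold identity
of `fold` keeps the exponentially small tail `√Q ∫_Q^∞ T w^{−1} + ∫_Q^∞ T w^{−1/2} ≤ 2Q^{−1/2}(20/19)e^{−πQ}/π`.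
[cite: Louboutin2001CJM, Thm 23 (45) p. 1210] -/
theorem fold_ge {Q : ℝ} (hQ : 1 ≤ Q) :
    (Q ^ (1 / 2 : ℝ) + 1) * mu + (Q ^ (1 / 2 : ℝ) - 1) / 2 * Real.log Q - Q ^ (-(1 / 2 : ℝ)) * rexp (-(π * Q)) ≤
      ∫ y in Ioi 1, thetaMajor (y / Q) * weight y := by
  have hQ0 : 0 < Q := by linarith
  have hQi : 0 < Q⁻¹ := inv_pos.mpr hQ0
  set d : ℝ := Q ^ (1 / 2 : ℝ) with hd
  have hd1 : 1 ≤ d := Real.one_le_rpow hQ (by norm_num)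
  -- the scaled weight
  set W : ℝ → ℝ := fun v ↦ d * v ^ (-(1 / 2 : ℝ)) + v⁻¹ with hW
  have hWcont : ContinuousOn W (Ioi 0) := by
    refine ContinuousOn.add (ContinuousOn.mul continuousOn_const
      (continuousOn_id.rpow_const fun x hx ↦ Or.inl (ne_of_gt hx)))
      (continuousOn_inv₀.mono fun x (hx : 0 < x) ↦ hx.ne')
  have hWbd : ∀ v, Q⁻¹ < v → |W v| ≤ d * Q ^ (1 / 2 : ℝ) + Q := by
    intro v hv
    have hv0 : 0 < v := hQi.trans hv
    have hWv : 0 ≤ W v := by simp only [hW]; positivity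
    rw [abs_of_nonneg hWv]
    have h1 : v ^ (-(1 / 2 : ℝ)) ≤ Q ^ (1 / 2 : ℝ) := by
      have : v ^ (-(1 / 2 : ℝ)) ≤ (Q⁻¹) ^ (-(1 / 2 : ℝ)) :=
        Real.rpow_le_rpow_of_nonpos hQi hv.le (by norm_num)
      rwa [Real.inv_rpow hQ0.le, ← Real.rpow_neg hQ0.le, neg_neg] at this
    have h2 : v⁻¹ ≤ Q := by
      rw [← inv_inv Q]; exact inv_anti₀ hQi hv.le
    have : d * v ^ (-(1 / 2 : ℝ)) ≤ d * Q ^ (1 / 2 : ℝ) := mul_le_mul_of_nonneg_left h1 (by linarith)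
    simp only [hW]; linarith
  have hTW : IntegrableOn (fun v ↦ thetaMajor v * W v) (Ioi Q⁻¹) :=
    integrableOn_thetaMajor_mul hQi hWcont hWbd
  -- Step 1: scaling `y = Q v`
  have step1 : ∫ y in Ioi 1, thetaMajor (y / Q) * weight y = ∫ v in Ioi Q⁻¹, thetaMajor v * W v := by
    have h := integral_comp_mul_left_Ioi (fun v ↦ thetaMajor v * (Q * weight (Q * v))) 1 hQi
    rw [mul_one] at h
    have lhs : (fun y ↦ thetaMajor (y / Q) * weight y) =
        fun y ↦ Q⁻¹ * (thetaMajor (Q⁻¹ * y) * (Q * weight (Q * (Q⁻¹ * y)))) := by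
      funext y
      rw [← mul_assoc Q, mul_inv_cancel₀ hQ0.ne', one_mul, div_eq_inv_mul]
      field_simp
    rw [lhs, integral_const_mul, h, smul_eq_mul, inv_inv, ← mul_assoc, inv_mul_cancel₀ hQ0.ne', one_mul]
    refine setIntegral_congr_fun measurableSet_Ioi fun v (hv : Q⁻¹ < v) ↦ ?_
    simp only [hW, hd]
    rw [mul_weight_mul hQ0 (hQi.trans hv)]
  -- Step 2: split at `v = 1`
  have hsplit : Ioi Q⁻¹ = Ioc Q⁻¹ 1 ∪ Ioi 1 :=
    (Ioc_union_Ioi_eq_Ioi (inv_le_one_of_one_le₀ hQ)).symm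
  have step2 : ∫ v in Ioi Q⁻¹, thetaMajor v * W v =
      (∫ v in Ioc Q⁻¹ 1, thetaMajor v * W v) + ∫ v in Ioi 1, thetaMajor v * W v := by
    rw [hsplit]
    exact setIntegral_union (Set.disjoint_left.mpr fun x hx hx' ↦ (not_lt.mpr hx.2) hx')
      measurableSet_Ioi (hTW.mono_set (by rw [hsplit]; exact subset_union_left))
      (hTW.mono_set (by rw [hsplit]; exact subset_union_right))
  -- the two basic integrals
  set A : ℝ := ∫ v in Ioi 1, thetaMajor v * v ^ (-(1 / 2 : ℝ)) with hA
  set B : ℝ := ∫ v in Ioi 1, thetaMajor v * v⁻¹ with hB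
  have hIA := integrableOn_thetaMajor_mul_rpow (-(1 / 2 : ℝ)) (by norm_num)
  have hIB : IntegrableOn (fun v ↦ thetaMajor v * v⁻¹) (Ioi 1) := by
    have := integrableOn_thetaMajor_mul_rpow (-1) (by norm_num)
    refine this.congr_fun (fun v (hv : 1 < v) ↦ ?_) measurableSet_Ioi
    simp only [Real.rpow_neg_one]
  have hmuAB : mu = A + B := mu_eq_add
  -- Step 3: the tail `∫_1^∞ T W = d A + B`
  have step3 : ∫ v in Ioi 1, thetaMajor v * W v = d * A + B := by
    have : (fun v ↦ thetaMajor v * W v) = fun v ↦ d * (thetaMajor v * v ^ (-(1 / 2 : ℝ))) + thetaMajor v * v⁻¹ := by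
      funext v; simp only [hW]; ring
    rw [this, integral_add (hIA.const_mul d) hIB, integral_const_mul]
  -- Step 4: the bulk `∫_{1/Q}^1 T W`, folded onto `(1, Q)` by `v = 1/w`
  have step4 : ∫ v in Ioc Q⁻¹ 1, thetaMajor v * W v =
      ∫ w in (1 : ℝ)..Q, thetaMajor (1 / w) * (d * (1 / w) ^ (-(1 / 2 : ℝ)) + (1 / w)⁻¹) * (w ^ 2)⁻¹ := by
    rw [← intervalIntegral.integral_of_le (inv_le_one_of_one_le₀ hQ)]
    -- substitution `v = f w = w⁻¹` on `[1, Q]`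
    have hderiv : ∀ x ∈ Set.uIcc (1 : ℝ) Q, HasDerivAt (fun w : ℝ ↦ w⁻¹) (-(x ^ 2)⁻¹) x := by
      intro x hx
      rw [Set.uIcc_of_le hQ] at hx
      exact hasDerivAt_inv (by linarith [hx.1])
    have hcont : ContinuousOn (fun x : ℝ ↦ -(x ^ 2)⁻¹) (Set.uIcc (1 : ℝ) Q) := by
      refine ContinuousOn.neg (ContinuousOn.inv₀ (continuousOn_pow 2) fun x hx ↦ ?_)
      rw [Set.uIcc_of_le hQ] at hx
      exact pow_ne_zero 2 (by linarith [hx.1])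
    have himg : (fun w : ℝ ↦ w⁻¹) '' Set.uIcc (1 : ℝ) Q ⊆ Ioi 0 := by
      rintro _ ⟨x, hx, rfl⟩
      rw [Set.uIcc_of_le hQ] at hx
      have hx0 : (0 : ℝ) < x := by linarith [hx.1]
      simpa only [mem_Ioi] using inv_pos.mpr hx0
    have hg : ContinuousOn (fun v ↦ thetaMajor v * W v) ((fun w : ℝ ↦ w⁻¹) '' Set.uIcc (1 : ℝ) Q) :=
      ((continuousOn_thetaMajor.mul hWcont).mono himg)
    have hsub := intervalIntegral.integral_comp_mul_deriv' hderiv hcont hg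
    -- hsub : ∫ x in 1..Q, ((T·W) ∘ inv) x * (-(x^2)⁻¹) = ∫ v in 1⁻¹..Q⁻¹, T v * W v
    rw [inv_one] at hsub
    rw [intervalIntegral.integral_symm, ← hsub, ← intervalIntegral.integral_neg]
    refine intervalIntegral.integral_congr fun w _ ↦ ?_
    simp only [Function.comp_apply, hW, one_div]
    ring
  -- Step 5: evaluate the folded integral
  have hfold_pt : ∀ w ∈ Set.uIcc (1 : ℝ) Q,
      thetaMajor (1 / w) * (d * (1 / w) ^ (-(1 / 2 : ℝ)) + (1 / w)⁻¹) * (w ^ 2)⁻¹ =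
        thetaMajor w * (d * w⁻¹ + w ^ (-(1 / 2 : ℝ))) +
        (1 / 2 : ℝ) * (d * w⁻¹ + w ^ (-(1 / 2 : ℝ)) - d * w ^ (-(3 / 2 : ℝ)) - w⁻¹) := by
    intro w hw
    rw [Set.uIcc_of_le hQ] at hw
    exact folded_integrand (by linarith [hw.1])
  have h0 : (0 : ℝ) ∉ Set.uIcc (1 : ℝ) Q := by
    rw [Set.uIcc_of_le hQ]; intro h; exact absurd h.1 (by norm_num)
  -- integrability on [1, Q] of the two pieces
  have hTcont : ContinuousOn (fun w ↦ thetaMajor w * (d * w⁻¹ + w ^ (-(1 / 2 : ℝ)))) (Set.uIcc (1 : ℝ) Q) := by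
    refine (continuousOn_thetaMajor.mul (ContinuousOn.add (ContinuousOn.mul continuousOn_const
      (continuousOn_inv₀.mono fun x (hx : 0 < x) ↦ hx.ne'))
      (continuousOn_id.rpow_const fun x hx ↦ Or.inl (ne_of_gt hx)))).mono ?_
    intro x hx; rw [Set.uIcc_of_le hQ] at hx; exact (show (0 : ℝ) < x by linarith [hx.1])
  have hI1 : IntervalIntegrable (fun w ↦ thetaMajor w * (d * w⁻¹ + w ^ (-(1 / 2 : ℝ)))) volume 1 Q :=
    hTcont.intervalIntegrable
  have hc1 : IntervalIntegrable (fun w : ℝ ↦ w⁻¹) volume 1 Q :=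
    intervalIntegral.intervalIntegrable_inv (fun x hx ↦ by
      rw [Set.uIcc_of_le hQ] at hx; exact (show (0 : ℝ) < x by linarith [hx.1]).ne') continuousOn_id
  have hc2 : IntervalIntegrable (fun w : ℝ ↦ w ^ (-(1 / 2 : ℝ))) volume 1 Q :=
    intervalIntegral.intervalIntegrable_rpow (Or.inr h0)
  have hc3 : IntervalIntegrable (fun w : ℝ ↦ w ^ (-(3 / 2 : ℝ))) volume 1 Q :=
    intervalIntegral.intervalIntegrable_rpow (Or.inr h0)
  have hI2 : IntervalIntegrable
      (fun w : ℝ ↦ d * w⁻¹ + w ^ (-(1 / 2 : ℝ)) - d * w ^ (-(3 / 2 : ℝ)) - w⁻¹) volume 1 Q :=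
    (((hc1.const_mul _).add hc2).sub (hc3.const_mul _)).sub hc1
  have step5 : ∫ w in (1 : ℝ)..Q, thetaMajor (1 / w) * (d * (1 / w) ^ (-(1 / 2 : ℝ)) + (1 / w)⁻¹) * (w ^ 2)⁻¹
      = (∫ w in (1 : ℝ)..Q, thetaMajor w * (d * w⁻¹ + w ^ (-(1 / 2 : ℝ)))) + (d - 1) / 2 * Real.log Q := by
    rw [intervalIntegral.integral_congr hfold_pt, intervalIntegral.integral_add hI1 (hI2.const_mul _),
      intervalIntegral.integral_const_mul, integral_hTerms hQ]
    ring
  -- Step 6: the `T`-part of the folded integral is `d B + A` minus an exponentially small tail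
  have step6 : d * B + A - Q ^ (-(1 / 2 : ℝ)) * rexp (-(π * Q)) ≤
      ∫ w in (1 : ℝ)..Q, thetaMajor w * (d * w⁻¹ + w ^ (-(1 / 2 : ℝ))) := by
    rw [intervalIntegral.integral_of_le hQ]
    set f : ℝ → ℝ := fun w ↦ thetaMajor w * (d * w⁻¹ + w ^ (-(1 / 2 : ℝ))) with hf
    have hI : IntegrableOn f (Ioi 1) := by
      have : f = fun w ↦ d * (thetaMajor w * w⁻¹) + thetaMajor w * w ^ (-(1 / 2 : ℝ)) := by
        funext w; simp only [hf]; ring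
      rw [this]; exact (hIB.const_mul d).add hIA
    have htot : ∫ w in Ioi 1, f w = d * B + A := by
      have : f = fun w ↦ d * (thetaMajor w * w⁻¹) + thetaMajor w * w ^ (-(1 / 2 : ℝ)) := by
        funext w; simp only [hf]; ring
      rw [this, integral_add (hIB.const_mul d) hIA, integral_const_mul]
    have hsplit' : Ioi (1 : ℝ) = Ioc 1 Q ∪ Ioi Q := (Ioc_union_Ioi_eq_Ioi hQ).symm
    have hunion : ∫ w in Ioi 1, f w = (∫ w in Ioc 1 Q, f w) + ∫ w in Ioi Q, f w := by
      rw [hsplit']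
      exact setIntegral_union (Set.disjoint_left.mpr fun x hx hx' ↦ (not_lt.mpr hx.2) hx')
        measurableSet_Ioi (hI.mono_set Ioc_subset_Ioi_self) (hI.mono_set (Ioi_subset_Ioi hQ))
    -- the tail `∫_Q^∞ f ≤ 2 Q^{-1/2} · (20/19) e^{-πQ}/π ≤ Q^{-1/2} e^{-πQ}`
    have hQhalf : 0 < Q ^ (-(1 / 2 : ℝ)) := Real.rpow_pos_of_pos hQ0 _
    have hdom : IntegrableOn (fun w ↦ 2 * Q ^ (-(1 / 2 : ℝ)) * (20 / 19) * rexp (-π * w)) (Ioi Q) :=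
      (exp_neg_integrableOn_Ioi Q Real.pi_pos).const_mul _
    have htail : ∫ w in Ioi Q, f w ≤ ∫ w in Ioi Q, 2 * Q ^ (-(1 / 2 : ℝ)) * (20 / 19) * rexp (-π * w) := by
      refine setIntegral_mono_on (hI.mono_set (Ioi_subset_Ioi hQ)) hdom measurableSet_Ioi
        fun w (hw : Q < w) ↦ ?_
      have hw1 : 1 < w := lt_of_le_of_lt hQ hw
      have hw0 : 0 < w := by linarith
      -- `T(w) ≤ (20/19) e^{-πw}` for `w ≥ 1`
      have hs : rexp (-(3 * π * w)) ≤ 1 / 20 := by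
        have h1 : rexp (-(3 * π * w)) ≤ rexp (-9) := by
          rw [Real.exp_le_exp]; have := Real.pi_gt_three; nlinarith
        have h2 : rexp 9 = rexp 1 ^ 9 := by rw [← Real.exp_nat_mul]; norm_num
        have h3 : (2 : ℝ) ≤ rexp 1 := by have := Real.add_one_le_exp (1 : ℝ); linarith
        have h4 : (2 : ℝ) ^ 9 ≤ rexp 1 ^ 9 := pow_le_pow_left₀ (by norm_num) h3 9
        have h5 : rexp (-9) ≤ 1 / 20 := by
          rw [Real.exp_neg, ← one_div]
          apply one_div_le_one_div_of_le (by norm_num)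
          rw [h2]; linarith
        exact h1.trans h5
      have hT : thetaMajor w ≤ 20 / 19 * rexp (-π * w) := by
        have h := thetaMajor_le_geom hw0
        have hden : 19 / 20 ≤ 1 - rexp (-(3 * π * w)) := by linarith
        calc thetaMajor w ≤ rexp (-(π * w)) / (1 - rexp (-(3 * π * w))) := h
          _ ≤ rexp (-(π * w)) / (19 / 20) :=
              div_le_div_of_nonneg_left (Real.exp_pos _).le (by norm_num) hden
          _ = 20 / 19 * rexp (-π * w) := by rw [neg_mul]; ring
      -- the weight `d w⁻¹ + w^{-1/2} ≤ 2 Q^{-1/2}` for `w ≥ Q`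
      have hwt : d * w⁻¹ + w ^ (-(1 / 2 : ℝ)) ≤ 2 * Q ^ (-(1 / 2 : ℝ)) := by
        have e1 : d * Q⁻¹ = Q ^ (-(1 / 2 : ℝ)) := by
          rw [hd, ← Real.rpow_neg_one, ← Real.rpow_add hQ0]; norm_num
        have i1 : d * w⁻¹ ≤ d * Q⁻¹ :=
          mul_le_mul_of_nonneg_left ((inv_le_inv₀ hw0 hQ0).mpr hw.le) (by linarith)
        have i2 : w ^ (-(1 / 2 : ℝ)) ≤ Q ^ (-(1 / 2 : ℝ)) :=
          Real.rpow_le_rpow_of_nonpos hQ0 hw.le (by norm_num)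
        linarith
      have hwt0 : 0 ≤ d * w⁻¹ + w ^ (-(1 / 2 : ℝ)) := by positivity
      calc f w = thetaMajor w * (d * w⁻¹ + w ^ (-(1 / 2 : ℝ))) := rfl
        _ ≤ (20 / 19 * rexp (-π * w)) * (2 * Q ^ (-(1 / 2 : ℝ))) :=
            mul_le_mul hT hwt hwt0 (by positivity)
        _ = 2 * Q ^ (-(1 / 2 : ℝ)) * (20 / 19) * rexp (-π * w) := by ring
    have hval : ∫ w in Ioi Q, 2 * Q ^ (-(1 / 2 : ℝ)) * (20 / 19) * rexp (-π * w) =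
        2 * Q ^ (-(1 / 2 : ℝ)) * (20 / 19) * (rexp (-π * Q) / π) := by
      rw [integral_const_mul, integral_exp_mul_Ioi (by linarith [Real.pi_pos]) Q]
      congr 1
      field_simp
    have hπ3 := Real.pi_gt_three
    have hexp0 : 0 < rexp (-π * Q) := Real.exp_pos _
    have htail' : ∫ w in Ioi Q, f w ≤ Q ^ (-(1 / 2 : ℝ)) * rexp (-(π * Q)) := by
      rw [hval] at htail
      have : 2 * Q ^ (-(1 / 2 : ℝ)) * (20 / 19) * (rexp (-π * Q) / π) ≤ Q ^ (-(1 / 2 : ℝ)) * rexp (-π * Q) := by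
        rw [show 2 * Q ^ (-(1 / 2 : ℝ)) * (20 / 19) * (rexp (-π * Q) / π) =
          Q ^ (-(1 / 2 : ℝ)) * rexp (-π * Q) * (40 / (19 * π)) by field_simp; ring]
        have h1 : 40 / (19 * π) ≤ 1 := by rw [div_le_one (by positivity)]; linarith
        have h0 : 0 ≤ Q ^ (-(1 / 2 : ℝ)) * rexp (-π * Q) := by positivity
        nlinarith
      rw [neg_mul] at this
      rw [show rexp (-π * Q) = rexp (-(π * Q)) by rw [neg_mul]] at htail
      linarith
    linarith [hunion, htot, htail']
  -- assemble
  rw [step1, step2, step3, step4, step5, hmuAB]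
  nlinarith [step6]


/-- `T` is antitone on `(0, ∞)`: `T(u') ≤ T(u)` for `0 < u ≤ u'`. [folklore] -/
private theorem thetaMajor_antitone {u u' : ℝ} (hu : 0 < u) (huu' : u ≤ u') : thetaMajor u' ≤ thetaMajor u := by
  refine hasSum_le (fun n ↦ ?_) (hasSum_thetaMajor (hu.trans_le huu')) (hasSum_thetaMajor hu)
  rw [Real.exp_le_exp]
  have : 0 ≤ π * ((n : ℝ) + 1) ^ 2 := by positivity
  nlinarith

/-- **Split-and-fold with a general majorant** (the argument of `norm_integral_le_majorant` for any
nonnegative `M` with `|Θ|, |Θ'| ≤ M` on `(0, ∞)` and `M·y^{−1/2}`, `M·y^{−1}` integrable on `(1, ∞)`):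
`|∫₀^∞ y^{−1/2} Θ(y) dy| ≤ ∫₁^∞ M(y)(y^{−1/2} + y^{−1}) dy`. [cite: Louboutin2001CJM, Thm 21 (43) p. 1209 / (51) p. 1211] -/
theorem norm_integral_le_of_majorant {Θ Θ' : ℝ → ℂ} {ε : ℂ} {M : ℝ → ℝ} (hε : ‖ε‖ ≤ 1)
    (hΘ : ∀ y, 0 < y → ‖Θ y‖ ≤ M y) (hΘ' : ∀ y, 0 < y → ‖Θ' y‖ ≤ M y)
    (hM0 : ∀ y, 1 < y → 0 ≤ M y)
    (hM1 : IntegrableOn (fun y ↦ M y * y ^ (-(1 / 2 : ℝ))) (Ioi 1))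
    (hM2 : IntegrableOn (fun y ↦ M y * y⁻¹) (Ioi 1))
    (htrans : ∀ y, 0 < y → Θ y = ε * ((y ^ (-(1 / 2 : ℝ)) : ℝ) : ℂ) * Θ' (1 / y))
    (hint : IntegrableOn (fun y ↦ ((y ^ (-(1 / 2 : ℝ)) : ℝ) : ℂ) * Θ y) (Ioi 0)) :
    ‖∫ y in Ioi 0, ((y ^ (-(1 / 2 : ℝ)) : ℝ) : ℂ) * Θ y‖ ≤ ∫ y in Ioi 1, M y * weight y := by
  set F : ℝ → ℂ := fun y ↦ ((y ^ (-(1 / 2 : ℝ)) : ℝ) : ℂ) * Θ y with hF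
  have hsplit : Ioi (0 : ℝ) = Ioc 0 1 ∪ Ioi 1 := (Ioc_union_Ioi_eq_Ioi zero_le_one).symm
  have hdisj : Disjoint (Ioc (0 : ℝ) 1) (Ioi 1) :=
    Set.disjoint_left.mpr fun x hx hx' ↦ (not_lt.mpr hx.2) hx'
  have hI1 : IntegrableOn F (Ioc 0 1) := hint.mono_set Ioc_subset_Ioi_self
  have hI2 : IntegrableOn F (Ioi 1) := hint.mono_set (Ioi_subset_Ioi zero_le_one)
  have e0 : ∫ y in Ioi 0, F y = (∫ y in Ioc 0 1, F y) + ∫ y in Ioi 1, F y := by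
    rw [hsplit]; exact setIntegral_union hdisj measurableSet_Ioi hI1 hI2
  have b2 : ‖∫ y in Ioi 1, F y‖ ≤ ∫ y in Ioi 1, M y * y ^ (-(1 / 2 : ℝ)) := by
    refine norm_integral_le_of_norm_le hM1 ?_
    refine (ae_restrict_iff' measurableSet_Ioi).mpr (ae_of_all _ fun y (hy : 1 < y) ↦ ?_)
    have hy0 : 0 < y := by linarith
    rw [hF, norm_mul, Complex.norm_real, Real.norm_eq_abs, abs_of_nonneg (Real.rpow_nonneg hy0.le _),
      mul_comm]
    exact mul_le_mul_of_nonneg_right (hΘ y hy0) (Real.rpow_nonneg hy0.le _)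
  have e1 : ∫ y in Ioc 0 1, F y = ε * ∫ x in Ioi 1, ((x⁻¹ : ℝ) : ℂ) * Θ' x := by
    have hsub := integral_comp_rpow_Ioi ((Ioc (0 : ℝ) 1).indicator F) (p := -1) (by norm_num)
    rw [setIntegral_indicator measurableSet_Ioc,
      show Ioi (0 : ℝ) ∩ Ioc 0 1 = Ioc 0 1 from Set.inter_eq_right.mpr Ioc_subset_Ioi_self] at hsub
    rw [← hsub]
    have hpt : ∀ x ∈ Ioi (0 : ℝ), (|(-1 : ℝ)| * x ^ ((-1 : ℝ) - 1)) • (Ioc (0 : ℝ) 1).indicator F (x ^ (-1 : ℝ))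
        = (Ici (1 : ℝ)).indicator (fun x ↦ ε * (((x⁻¹ : ℝ) : ℂ) * Θ' x)) x := by
      intro x hx
      have hx0 : 0 < x := hx
      rw [Real.rpow_neg_one]
      by_cases h1 : 1 ≤ x
      · have hmem : x⁻¹ ∈ Ioc (0 : ℝ) 1 := ⟨inv_pos.mpr hx0, inv_le_one_of_one_le₀ h1⟩
        rw [indicator_of_mem hmem, indicator_of_mem (show x ∈ Ici (1 : ℝ) from h1), hF]
        simp only
        have e1 : (x⁻¹) ^ (-(1 / 2 : ℝ)) = x ^ (1 / 2 : ℝ) := by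
          rw [Real.inv_rpow hx0.le, ← Real.rpow_neg hx0.le, neg_neg]
        have e3 : (1 : ℝ) / x⁻¹ = x := by rw [one_div, inv_inv]
        rw [htrans x⁻¹ (inv_pos.mpr hx0), e3, e1, abs_neg, abs_one, one_mul,
          show ((-1 : ℝ) - 1) = -2 by norm_num]
        have e2 : x ^ (-2 : ℝ) * x ^ (1 / 2 : ℝ) * x ^ (1 / 2 : ℝ) = x⁻¹ := by
          rw [← Real.rpow_add hx0, ← Real.rpow_add hx0, ← Real.rpow_neg_one]; norm_num
        rw [Complex.real_smul]
        have e2c : ((x ^ (-2 : ℝ) : ℝ) : ℂ) * ((x ^ (1 / 2 : ℝ) : ℝ) : ℂ) * ((x ^ (1 / 2 : ℝ) : ℝ) : ℂ) =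
            ((x⁻¹ : ℝ) : ℂ) := by
          rw [← Complex.ofReal_mul, ← Complex.ofReal_mul, e2]
        linear_combination (ε * Θ' x : ℂ) * e2c
      · push Not at h1
        have hnmem : x⁻¹ ∉ Ioc (0 : ℝ) 1 := fun h ↦ by
          have := h.2; rw [inv_le_one_iff₀] at this
          rcases this with h' | h' <;> linarith
        rw [indicator_of_notMem hnmem, indicator_of_notMem (show x ∉ Ici (1 : ℝ) from not_le.mpr h1),
          smul_zero]
    rw [setIntegral_congr_fun measurableSet_Ioi hpt, setIntegral_indicator measurableSet_Ici,
      show Ioi (0 : ℝ) ∩ Ici 1 = Ici 1 from Set.inter_eq_right.mpr fun x (hx : 1 ≤ x) ↦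
        (show (0 : ℝ) < x by exact lt_of_lt_of_le one_pos hx),
      integral_Ici_eq_integral_Ioi, integral_const_mul]
  have b1 : ‖∫ y in Ioc 0 1, F y‖ ≤ ∫ y in Ioi 1, M y * y⁻¹ := by
    rw [e1, norm_mul]
    have hn : ‖∫ x in Ioi 1, ((x⁻¹ : ℝ) : ℂ) * Θ' x‖ ≤ ∫ y in Ioi 1, M y * y⁻¹ := by
      refine norm_integral_le_of_norm_le hM2 ?_
      refine (ae_restrict_iff' measurableSet_Ioi).mpr (ae_of_all _ fun y (hy : 1 < y) ↦ ?_)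
      have hy0 : 0 < y := by linarith
      rw [norm_mul, Complex.norm_real, Real.norm_eq_abs, abs_of_nonneg (inv_pos.mpr hy0).le, mul_comm]
      exact mul_le_mul_of_nonneg_right (hΘ' y hy0) (inv_pos.mpr hy0).le
    have h0 : 0 ≤ ∫ y in Ioi 1, M y * y⁻¹ :=
      setIntegral_nonneg measurableSet_Ioi fun y (hy : 1 < y) ↦ by
        have : 0 < y := by linarith
        exact mul_nonneg (hM0 y hy) (inv_pos.mpr this).le
    calc ‖ε‖ * ‖∫ x in Ioi 1, ((x⁻¹ : ℝ) : ℂ) * Θ' x‖ ≤ 1 * ∫ y in Ioi 1, M y * y⁻¹ :=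
          mul_le_mul hε hn (norm_nonneg _) zero_le_one
      _ = _ := one_mul _
  have esum : (∫ y in Ioi 1, M y * y⁻¹) + (∫ y in Ioi 1, M y * y ^ (-(1 / 2 : ℝ))) =
      ∫ y in Ioi 1, M y * weight y := by
    rw [← integral_add hM2 hM1]
    refine setIntegral_congr_fun measurableSet_Ioi fun y _ ↦ ?_
    simp only [weight]; ring
  calc ‖∫ y in Ioi 0, F y‖ = ‖(∫ y in Ioc 0 1, F y) + ∫ y in Ioi 1, F y‖ := by rw [e0]
    _ ≤ ‖∫ y in Ioc 0 1, F y‖ + ‖∫ y in Ioi 1, F y‖ := norm_add_le _ _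
    _ ≤ (∫ y in Ioi 1, M y * y⁻¹) + ∫ y in Ioi 1, M y * y ^ (-(1 / 2 : ℝ)) := add_le_add b1 b2
    _ = ∫ y in Ioi 1, M y * weight y := esum

section DirichletEvenConductor

open DirichletCharacter DirichletTheta

variable {q : ℕ} [NeZero q]

/-- **The majorant for an even conductor**: if `2 ∣ q` then `χ(n) = 0` for even `n`, so
`|ϑ₀(y, χ)| ≤ 2 Σ_{n ≥ 1 odd} e^{−πn²y/q} = 2(T(y/q) − T(4y/q))` (`y > 0`, `χ` even). [cite: Louboutin2001CJM, Thm 23 (proof) p. 1211] -/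
theorem norm_dirichletTheta_zero_le_sub (χ : DirichletCharacter ℂ q) (heven : χ.Even) (h2 : 2 ∣ q)
    (hq : q ≠ 1) {y : ℝ} (hy : 0 < y) :
    ‖dirichletTheta 0 χ y‖ ≤ 2 * (thetaMajor (y / q) - thetaMajor (4 * (y / q))) := by
  have hq0 : (0 : ℝ) < q := by exact_mod_cast NeZero.pos q
  have hu : 0 < y / q := div_pos hy hq0
  have hpar : χ (-1) = (-1) ^ (0 : ℕ) := by rw [pow_zero]; exact heven
  have h := hasSum_nat_dirichletTheta hpar hq hy
  -- the odd-index majorant series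
  set e : ℕ → ℝ := fun n ↦ rexp (-(π * ((n : ℝ) + 1) ^ 2 * (y / q))) with he
  set b : ℕ → ℝ := fun n ↦ if _root_.Even (n + 1) then 0 else e n with hb
  have hall : HasSum e (thetaMajor (y / q)) := hasSum_thetaMajor hu
  -- the even-index subseries sums to `T(4y/q)`
  have heven_sum : HasSum (fun n ↦ if _root_.Even (n + 1) then e n else 0) (thetaMajor (4 * (y / q))) := by
    have h4 := hasSum_thetaMajor (mul_pos four_pos hu)
    have hinj : Function.Injective (fun m : ℕ ↦ 2 * m + 1) := fun a b hab ↦ by simpa using hab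
    have key := (hinj.hasSum_iff (f := fun n ↦ if _root_.Even (n + 1) then e n else 0) (a := thetaMajor (4 * (y / q)))
      (fun n hn ↦ ?_)).mp ?_
    · exact key
    · -- off the range of `m ↦ 2m+1`, `n` is even, so `n + 1` is odd
      have hne : ¬ _root_.Even (n + 1) := by
        intro hev
        apply hn
        obtain ⟨k, hk⟩ := hev
        refine ⟨k - 1, ?_⟩
        simp only
        omega
      simp [hne]
    · refine h4.congr_fun fun m ↦ ?_
      have hev : _root_.Even (2 * m + 1 + 1) := ⟨m + 1, by ring⟩
      simp only [Function.comp_apply, if_pos hev, he]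
      push_cast
      ring_nf
  have hbsum : HasSum b (thetaMajor (y / q) - thetaMajor (4 * (y / q))) := by
    have := hall.sub heven_sum
    refine this.congr_fun fun n ↦ ?_
    simp only [hb]
    split_ifs <;> simp
  have hT := hbsum.mul_left 2
  rw [← h.tsum_eq]
  refine tsum_of_norm_bounded hT fun n ↦ ?_
  rw [norm_mul, Complex.norm_ofNat]
  refine mul_le_mul_of_nonneg_left ?_ zero_le_two
  unfold thetaTerm
  rw [norm_mul, norm_mul, pow_zero, norm_one, mul_one, Complex.norm_real, Real.norm_eq_abs,
    abs_of_nonneg (Real.exp_pos _).le]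
  have h2' : rexp (-(π * (((n : ℤ) + 1 : ℤ) : ℝ) ^ 2 * y / q)) = e n := by
    simp only [he]; push_cast; ring_nf
  rw [h2']
  simp only [hb]
  split_ifs with hpar2
  · -- `n + 1` even ⇒ `χ(n+1) = 0`
    have hnu : ¬ IsUnit ((((n : ℤ) + 1 : ℤ) : ZMod q)) := by
      rw [show (((n : ℤ) + 1 : ℤ) : ZMod q) = ((n + 1 : ℕ) : ZMod q) by push_cast; ring]
      rw [ZMod.isUnit_iff_coprime]
      intro hcop
      obtain ⟨k, hk⟩ := hpar2
      obtain ⟨m, hm⟩ := h2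
      have : 2 ∣ Nat.gcd (n + 1) q := Nat.dvd_gcd ⟨k, by omega⟩ ⟨m, hm⟩
      rw [hcop] at this
      omega
    rw [χ.map_nonunit hnu, norm_zero, zero_mul]
  · calc ‖χ (((n : ℤ) + 1 : ℤ) : ZMod q)‖ * e n ≤ 1 * e n :=
        mul_le_mul_of_nonneg_right (χ.norm_le_one _) (Real.exp_pos _).le
      _ = e n := one_mul _

/-- **Louboutin 1993, second inequality** (C. R. Acad. Sci. Paris 316 (1993) 11–14 = [Lou1] of CJM 2001 Thm 7;
Zbl 0774.11051: «Let `χ` be an even primitive Dirichlet character to the modulus `f` … the author proves the upper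
bounds `|L(1,χ)| ≤ ½ log f + (2+γ−log(4π))/2` in general, and `|L(1,χ)| ≤ ¼ log f + (2+γ−log π)/4` for an even `f`»):
for an even primitive Dirichlet character `χ` of EVEN conductor `f ≥ 8` (no even primitive character has an even
conductor `< 8`), **`|L(1, χ)| ≤ ¼ log f + (2 + γ − log π)/4`** (`= ¼ log f + 0.358…`). Proof: `χ(n) = 0` for even `n`, so the
Gaussian majorant is `2(T(y/f) − T(4y/f))` (`norm_dirichletTheta_zero_le_sub`); the split-and-fold bound with
this majorant (`norm_integral_le_of_majorant`) gives `√f |L(1, χ)| ≤ fold(f) − fold(f/4)`, and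
`fold(f) ≤ (√f + 1)µ_ℚ + ½(√f − 1) log f` (`fold`), `fold(f/4) ≥ (√f/2 + 1)µ_ℚ + ½(√f/2 − 1) log(f/4) − 2f^{−1/2}e^{−πf/4}`
(`fold_ge`); the difference is `(√f/2)(µ_ℚ + ½ log f + log 2) − log 2 + 2f^{−1/2}e^{−πf/4}`, and
`(µ_ℚ + log 2)/2 = (2 + γ − log π)/4` (`µ_ℚ = 1 + (γ − log 4π)/2`). [cite: Louboutin1993CRAS, second inequality (Zbl 0774.11051)]
[cite: Louboutin2001CJM, Thm 7 p. 1197 («See also [Lou1]»)] -/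
theorem norm_LFunction_one_le_quarter_log (χ : DirichletCharacter ℂ q) (hprim : χ.IsPrimitive)
    (hχ : χ ≠ 1) (heven : χ.Even) (h2 : 2 ∣ q) (hq8 : 8 ≤ q) :
    ‖χ.LFunction 1‖ ≤ Real.log q / 4 + (2 + Real.eulerMascheroniConstant - Real.log π) / 4 := by
  have hq1 : q ≠ 1 := by rintro rfl; exact hχ χ.level_one
  have hq0 : (0 : ℝ) < q := by exact_mod_cast NeZero.pos q
  have hq8' : (8 : ℝ) ≤ q := by exact_mod_cast hq8
  have hκ : charParity χ = 0 := charParity_of_even heven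
  set Q : ℝ := (q : ℝ) / 4 with hQdef
  have hQ2 : 2 ≤ Q := by rw [hQdef]; linarith
  have hQ1 : 1 ≤ Q := by linarith
  have hQ0 : 0 < Q := by linarith
  -- the majorant `M(y) = 2 (T(y/q) − T(y/Q))`
  set M : ℝ → ℝ := fun y ↦ 2 * (thetaMajor (y / q) - thetaMajor (y / Q)) with hM
  have hMq : ∀ y : ℝ, y / Q = 4 * (y / q) := by intro y; rw [hQdef]; field_simp
  have hΘ : ∀ y, 0 < y → ‖dirichletTheta 0 χ y‖ ≤ M y := by
    intro y hy; rw [hM]; simp only; rw [hMq]; exact norm_dirichletTheta_zero_le_sub χ heven h2 hq1 hy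
  have hΘ' : ∀ y, 0 < y → ‖dirichletTheta 0 χ⁻¹ y‖ ≤ M y := by
    intro y hy; rw [hM]; simp only; rw [hMq]; exact norm_dirichletTheta_zero_le_sub χ⁻¹ (even_inv heven) h2 hq1 hy
  have hM0 : ∀ y, 1 < y → 0 ≤ M y := by
    intro y hy
    have hy0 : 0 < y := by linarith
    have : thetaMajor (y / Q) ≤ thetaMajor (y / q) := by
      rw [hMq]; exact thetaMajor_antitone (div_pos hy0 hq0) (by linarith [div_pos hy0 hq0])
    simp only [hM]; linarith
  have hM1 : IntegrableOn (fun y ↦ M y * y ^ (-(1 / 2 : ℝ))) (Ioi 1) := by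
    have a := integrableOn_thetaMajor_div_mul_rpow hq0 (-(1 / 2 : ℝ)) (by norm_num)
    have b := integrableOn_thetaMajor_div_mul_rpow hQ0 (-(1 / 2 : ℝ)) (by norm_num)
    have hab : IntegrableOn (fun y ↦ 2 * (thetaMajor (y / q) * y ^ (-(1 / 2 : ℝ)) -
        thetaMajor (y / Q) * y ^ (-(1 / 2 : ℝ)))) (Ioi 1) := (a.sub b).const_mul 2
    refine hab.congr_fun (fun y _ ↦ ?_) measurableSet_Ioi
    simp only [hM]; ring
  have hM2 : IntegrableOn (fun y ↦ M y * y⁻¹) (Ioi 1) := by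
    have a := integrableOn_thetaMajor_div_mul_rpow hq0 (-1) (by norm_num)
    have b := integrableOn_thetaMajor_div_mul_rpow hQ0 (-1) (by norm_num)
    have hab : IntegrableOn (fun y ↦ 2 * (thetaMajor (y / q) * y ^ (-1 : ℝ) -
        thetaMajor (y / Q) * y ^ (-1 : ℝ))) (Ioi 1) := (a.sub b).const_mul 2
    refine hab.congr_fun (fun y _ ↦ ?_) measurableSet_Ioi
    simp only [hM, Real.rpow_neg_one]; ring
  -- `ξ(1, χ) = ½ ∫₀^∞ y^{-1/2} ϑ₀(y, χ) dy` and `‖ξ(1, χ)‖ = √q |L(1, χ)|`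
  have hxi := dirichletXi_eq_mellin hχ 1
  rw [hκ, Nat.cast_zero, add_zero] at hxi
  have hmel : mellin (dirichletTheta 0 χ) (1 / 2) =
      ∫ y in Ioi 0, (((y ^ (-(1 / 2 : ℝ))) : ℝ) : ℂ) * dirichletTheta 0 χ y := by
    rw [mellin]
    refine setIntegral_congr_fun measurableSet_Ioi fun y (hy : 0 < y) ↦ ?_
    rw [smul_eq_mul, show (1 / 2 : ℂ) - 1 = ((-(1 / 2) : ℝ) : ℂ) by push_cast; ring,
      Complex.ofReal_cpow hy.le]
  have hxiL := dirichletXi_eq_LFunction_mul hχ (s := 1) (fun n ↦ by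
    rw [hκ, Nat.cast_zero, add_zero]
    intro h
    have := congrArg Complex.re h
    simp at this
    linarith)
  rw [hκ, Nat.cast_zero, add_zero] at hxiL
  have hnormxi : ‖dirichletXi χ 1‖ = (q : ℝ) ^ (1 / 2 : ℝ) * ‖χ.LFunction 1‖ := by
    have e1 : ‖Complex.Gamma (1 / 2)‖ = π ^ (1 / 2 : ℝ) := by
      rw [Complex.Gamma_one_half_eq, Complex.norm_cpow_eq_rpow_re_of_pos Real.pi_pos]
      norm_num
    have e2 : ‖((q : ℂ) / π) ^ (1 / 2 : ℂ)‖ = ((q : ℝ) / π) ^ (1 / 2 : ℝ) := by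
      rw [show ((q : ℂ) / π) = (((q : ℝ) / π : ℝ) : ℂ) by push_cast; rfl,
        Complex.norm_cpow_eq_rpow_re_of_pos (div_pos hq0 Real.pi_pos)]
      norm_num
    rw [hxiL, norm_mul, norm_mul, e1, e2, mul_assoc,
      ← Real.mul_rpow Real.pi_pos.le (div_pos hq0 Real.pi_pos).le,
      mul_div_cancel₀ _ Real.pi_pos.ne', mul_comm]
  -- the split-and-fold bound with the even-conductor majorant
  have hmaj : ‖∫ y in Ioi 0, (((y ^ (-(1 / 2 : ℝ))) : ℝ) : ℂ) * dirichletTheta 0 χ y‖ ≤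
      ∫ y in Ioi 1, M y * weight y := by
    refine norm_integral_le_of_majorant (Θ' := dirichletTheta 0 χ⁻¹) (ε := rootNumber χ)
      (le_of_eq (SelbergDirichlet.norm_rootNumber hprim)) hΘ hΘ' hM0 hM1 hM2 (fun y hy ↦ ?_) ?_
    · have h := dirichletTheta_transformation hprim hy
      rw [hκ, Nat.cast_zero, add_zero] at h
      exact h
    · have h := mellinConvergent_dirichletTheta_zero hχ (1 / 2)
      rw [MellinConvergent] at h
      refine h.congr_fun (fun y (hy : 0 < y) ↦ ?_) measurableSet_Ioi
      show (y : ℂ) ^ ((1 : ℂ) / 2 - 1) • dirichletTheta 0 χ y = _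
      rw [smul_eq_mul, show (1 / 2 : ℂ) - 1 = ((-(1 / 2) : ℝ) : ℂ) by push_cast; ring,
        Complex.ofReal_cpow hy.le]
  -- `∫ M w = 2 (fold q − fold Q)`
  have hIq : IntegrableOn (fun y ↦ thetaMajor (y / q) * weight y) (Ioi 1) := by
    have a := integrableOn_thetaMajor_div_mul_rpow hq0 (-(1 / 2 : ℝ)) (by norm_num)
    have b := integrableOn_thetaMajor_div_mul_rpow hq0 (-1) (by norm_num)
    have hab : IntegrableOn (fun y ↦ thetaMajor (y / q) * y ^ (-(1 / 2 : ℝ)) +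
        thetaMajor (y / q) * y ^ (-1 : ℝ)) (Ioi 1) := a.add b
    refine hab.congr_fun (fun y _ ↦ ?_) measurableSet_Ioi
    simp only [weight, Real.rpow_neg_one]; ring
  have hIQ : IntegrableOn (fun y ↦ thetaMajor (y / Q) * weight y) (Ioi 1) := by
    have a := integrableOn_thetaMajor_div_mul_rpow hQ0 (-(1 / 2 : ℝ)) (by norm_num)
    have b := integrableOn_thetaMajor_div_mul_rpow hQ0 (-1) (by norm_num)
    have hab : IntegrableOn (fun y ↦ thetaMajor (y / Q) * y ^ (-(1 / 2 : ℝ)) +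
        thetaMajor (y / Q) * y ^ (-1 : ℝ)) (Ioi 1) := a.add b
    refine hab.congr_fun (fun y _ ↦ ?_) measurableSet_Ioi
    simp only [weight, Real.rpow_neg_one]; ring
  have hMint : ∫ y in Ioi 1, M y * weight y =
      2 * ((∫ y in Ioi 1, thetaMajor (y / q) * weight y) - ∫ y in Ioi 1, thetaMajor (y / Q) * weight y) := by
    rw [← integral_sub hIq hIQ, ← integral_const_mul]
    refine setIntegral_congr_fun measurableSet_Ioi fun y _ ↦ ?_
    simp only [hM]; ring
  -- the two folds
  have hq1' : (1 : ℝ) ≤ q := by linarith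
  have hup := fold hq1'
  have hlo := fold_ge hQ1
  -- `√q |L(1,χ)| ≤ fold q − fold Q`
  have hchain : (q : ℝ) ^ (1 / 2 : ℝ) * ‖χ.LFunction 1‖ ≤
      (∫ y in Ioi 1, thetaMajor (y / q) * weight y) - ∫ y in Ioi 1, thetaMajor (y / Q) * weight y := by
    rw [← hnormxi, hxi, hmel, norm_mul]
    have : ‖(1 / 2 : ℂ)‖ = 1 / 2 := by norm_num
    rw [this]
    linarith [hmaj, hMint]
  -- numerics: `d = √q`, `√Q = d/2`, `log Q = log q − log 4`
  set d : ℝ := (q : ℝ) ^ (1 / 2 : ℝ) with hd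
  have hd0 : 0 < d := Real.rpow_pos_of_pos hq0 _
  have hdQ : Q ^ (1 / 2 : ℝ) = d / 2 := by
    rw [hQdef, Real.div_rpow hq0.le (by norm_num), hd]
    congr 1
    rw [show (4 : ℝ) = 2 ^ (2 : ℝ) by norm_num, ← Real.rpow_mul (by norm_num)]; norm_num
  have hlogQ : Real.log Q = Real.log q - Real.log 4 := by
    rw [hQdef, Real.log_div hq0.ne' (by norm_num)]
  have hlog4 : Real.log 4 = 2 * Real.log 2 := by
    rw [show (4 : ℝ) = 2 ^ 2 by norm_num, Real.log_pow]; norm_num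
  -- the tail `Q^{-1/2} e^{-πQ} ≤ (1/2) log 2` (indeed tiny)
  have htail : Q ^ (-(1 / 2 : ℝ)) * rexp (-(π * Q)) ≤ Real.log 2 / 2 := by
    have h1 : Q ^ (-(1 / 2 : ℝ)) ≤ 1 := Real.rpow_le_one_of_one_le_of_nonpos hQ1 (by norm_num)
    have h2 : rexp (-(π * Q)) ≤ rexp (-6) := Real.exp_le_exp.mpr (by nlinarith [Real.pi_gt_three])
    have h3 : rexp (-6) ≤ 1 / 4 := by
      rw [Real.exp_neg, ← one_div]
      apply one_div_le_one_div_of_le (by norm_num)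
      have := Real.add_one_le_exp (6 : ℝ); linarith
    have h4 := Real.log_two_gt_d9
    calc Q ^ (-(1 / 2 : ℝ)) * rexp (-(π * Q)) ≤ 1 * (1 / 4) :=
          mul_le_mul h1 (h2.trans h3) (Real.exp_pos _).le zero_le_one
      _ ≤ Real.log 2 / 2 := by linarith
  -- `mu + log 2 = (2 + γ − log π)/2`
  have hmu : mu + Real.log 2 = (2 + Real.eulerMascheroniConstant - Real.log π) / 2 := by
    rw [mu_eq, show (4 : ℝ) * π = 2 ^ 2 * π by norm_num, Real.log_mul (by norm_num) Real.pi_pos.ne',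
      Real.log_pow]
    push_cast
    ring
  -- assemble: `d |L| ≤ (d/2)(mu + ½ log q + log 2) − log 2 + Q^{-1/2}e^{-πQ}`
  rw [hdQ, hlogQ, hlog4] at hlo
  have hkey : d * ‖χ.LFunction 1‖ ≤ d / 2 * (mu + Real.log q / 2 + Real.log 2) - Real.log 2 / 2 := by
    linarith [hchain, hup, hlo, htail]
  have hfin : ‖χ.LFunction 1‖ ≤ (mu + Real.log q / 2 + Real.log 2) / 2 := by
    have : d * ‖χ.LFunction 1‖ ≤ d * ((mu + Real.log q / 2 + Real.log 2) / 2) := by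
      have h0 : 0 ≤ Real.log 2 / 2 := by have := Real.log_two_gt_d9; linarith
      linarith
    exact le_of_mul_le_mul_left this hd0
  rw [show (mu + Real.log q / 2 + Real.log 2) / 2 = Real.log q / 4 + (mu + Real.log 2) / 2 by ring, hmu] at hfin
  linarith

/-- Decimal form: `|L(1, χ)| ≤ ¼ log f + 0.3582` for an even primitive `χ` of even conductor `f ≥ 8`
(`(2 + γ − log π)/4 = 0.35812…`). [cite: Louboutin1993CRAS, second inequality (Zbl 0774.11051)] -/
theorem norm_LFunction_one_le_quarter_log_add (χ : DirichletCharacter ℂ q) (hprim : χ.IsPrimitive)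
    (hχ : χ ≠ 1) (heven : χ.Even) (h2 : 2 ∣ q) (hq8 : 8 ≤ q) :
    ‖χ.LFunction 1‖ ≤ Real.log q / 4 + 0.3582 := by
  have h := norm_LFunction_one_le_quarter_log χ hprim hχ heven h2 hq8
  have h1 := mu_lt
  have hmu : (2 + Real.eulerMascheroniConstant - Real.log π) / 4 = (mu + Real.log 2) / 2 := by
    rw [mu_eq, show (4 : ℝ) * π = 2 ^ 2 * π by norm_num, Real.log_mul (by norm_num) Real.pi_pos.ne',
      Real.log_pow]
    push_cast
    ring
  have h2' := Real.log_two_lt_d9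
  rw [hmu] at h
  linarith

end DirichletEvenConductor

end EvenConductor

end Louboutin2001

end Literature.NumberTheory.LFunctions
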